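import Literature.MathematicalPhysics.QuantumFieldTheory.Balaban1983to89.B12EdgeTreeLength257
import Literature.MathematicalPhysics.QuantumFieldTheory.Balaban1983to89.B12ShortestGraph257

/-!
# `Balaban1983to89.B12EdgeTreeLength257L1` — [Balaban1987RG1] p. 257, the ℓ¹ READING of «there are also the shortest
tree graphs formed by edges of cubes in X»: for the ℓ¹ length of polygonal graphs the continuum linear size EQUALS the
edge length, `treeLen1 X = edgeLen X` (proved, every dimension d, every finite set of unit cubes X carrying an
admissible graph), by RECTIFICATION (staircases in cubes) and GRID SNAPPING (sliding non-integer levels)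

statement-level skeleton of published theorems with citation tags; proofs where landed; nothing here is a claim about
the Yang–Mills mass gap

CITATION HEADER (lean-in-tree rule 2026-08-18).  Source under audit: T. Bałaban, *Renormalization group approach to
lattice gauge field theories. I. Generation of effective actions in a small field approximation and a coupling
constant renormalization in four dimensions*, Commun. Math. Phys. **109**, 249–301 (1987) [Balaban1987RG1] (cell paper
B12 = "[I]"; held `paper:balaban1987-cmp109-rg-i-small-field`, journal page = PDF page + 248; p. 257 = PDF p. 9).
Satellite of `…Balaban1983to89.TreeLength` (the continuum linear size `treeLen`, SUP metric of [Dimock2013BalabanII]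
App. E), of `…Balaban1983to89.B12EdgeTreeLength257` (edge graphs `EAdmissible`, `nedges`, `edgeLen`; its HONEST SCOPE
(a): «of the usual norms only the ℓ¹ reading is not separated by the witnesses of this file … no claim either way is
made here about the ℓ¹ reading of the sentence» — the present file settles that reading) and of
`…Balaban1983to89.B12ShortestGraph257` (only `reflTransGen_of_isPreconnected_iUnion` and `mem_carrier_flatten` are
used); nothing existing is modified.  Cell records: ROWS-B12 (r09) row B12.Note@257; DIVERGENCE D-T2 (the print names
no metric for the length of a graph); GAPS.md G-B12-08.  Unit `lit-balaban-r09` gen 15 (reader/typer r09, display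
owner of B12).

WHAT THE PAPER PRINTS (p. 257, verbatim).  *"A length of a shortest graph in this class, divided by M, is the linear
size of X … Let us stress the fact that we consider graphs in the continuous space. For a given X usually there are
many of these shortest tree graphs. It is easy to see that there are also the shortest tree graphs formed by edges of
cubes in X, hence an equivalent definition can be formulated, based on such graphs only."*

WHAT IS FORMALISED HERE (kernel-checked; objects of `TreeLength`/`B12EdgeTreeLength257`: unit cubes `cube x`,
polygonal graphs = lists of segments `T` with `carrier T`, `Admissible X T`, edge graphs `E` with `EAdmissible X E`,
`nedges E`, `edgeLen X`).
* §1 — the ℓ¹ LENGTH `len1 T` (sum of the ℓ¹ lengths `dist1` of the segments) and the ℓ¹ LINEAR SIZE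
  `treeLen1 X := inf {len1 T | Admissible X T}`; `treeLen X ≤ treeLen1 X` (sup ≤ ℓ¹); a unit edge has ℓ¹ length 1, so
  `len1 (toSegs E) = nedges E` and `treeLen1 X ≤ edgeLen X`.
* §2 (PHASE III) — a RECTILINEAR graph (every segment parallel to an axis) with LATTICE endpoints is an edge graph
  with the same carrier and `nedges = len1` (`exists_eAdmissible_of_rectilinear_lattice`: an axis-parallel lattice
  segment is a chain of unit edges, each an edge of the cube of X containing its midpoint); hence `edgeLen X ≤ len1 T`
  for such T.
* §3–§5 (PHASE II, GRID SNAPPING) — for a rectilinear admissible graph with a non-integer endpoint level s in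
  coordinate i, the piecewise-linear SLIDE x_i ↦ x_i + t·tent(x_i) (supported in (s⁻, s⁺), where s⁻ < s < s⁺ are
  the nearest endpoint levels or integers below and above s, so that no integer lies strictly between them) is
  monotone in x_i for s⁻ − s ≤ t ≤ s⁺ − s, maps every unit cube into itself (`Fmove_mem_cube`), maps axis-parallel
  segments onto axis-parallel segments (`image_Fmove_segment`), so the slid graph is admissible and rectilinear
  (`admissible_slide`) with endpoint levels moved only at s; its ℓ¹
  length is AFFINE in t (`len1_slide`), hence sliding the level s all the way to s⁻ or to s⁺ — whichever direction has
  non-positive slope — does not increase `len1` and removes the bad level (i, s) without creating new ones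
  (`snapping_step`); induction on the number of bad levels gives a rectilinear admissible graph with lattice endpoints
  and `len1` not larger (`exists_lattice_of_rectilinear`), so `edgeLen X ≤ len1 T` for every RECTILINEAR admissible T
  (`edgeLen_le_len1_of_rectilinear`).
* §6 (PHASE I, RECTIFICATION) — every admissible graph T is dominated in ℓ¹ length by a rectilinear admissible graph
  (`exists_rectilinear_admissible`): each segment σ is cut at finitely many parameters (`cutParams`: 0, 1, the
  parameters of the ANCHORS — one common point for every pair of meeting segments of T and one point of T in every
  cube of X — and the entry/exit parameters `loParam`/`hiParam` of σ for every cube of X); between consecutive cut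
  parameters σ stays in ONE cube of X (`exists_common_cube`: the cube containing the midpoint, by closedness of its
  parameter interval), and the piece is replaced by the axis-parallel STAIRCASE with the same endpoints inside that
  cube (`staircase`: same ℓ¹ length `len1_staircase`, connected, in the cube since cubes are boxes); the rectified
  graph contains all anchors (`mem_carrier_rectify_of_mem`), so it meets every cube of X and is connected — the
  intersection graph of the segments of T is connected (`B12ShortestGraph257.reflTransGen_of_isPreconnected_iUnion`)
  and meeting segments share an anchor lying on both rectifications (Mathlib `IsConnected.iUnion_of_reflTransGen`).
* §7 — MAIN: `edgeLen_le_len1` (every admissible T), `treeLen1_eq_edgeLen` (treeLen1 X = edgeLen X whenever X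
  carries an admissible graph; `treeLen1_eq_edgeLen_of_faceConnected` for localization domains),
  `exists_edgeGraph_len1_eq_treeLen1` (a shortest admissible EDGE graph is an ℓ¹-shortest admissible graph — the
  ℓ¹ linear size is attained by «tree graphs formed by edges of cubes»), `exists_eAdmissible_of_admissible`, and the
  comparison with the length of record `treeLen_block_lt_treeLen1_block` (treeLen < treeLen1 on the 3^d block, d ≥ 2,
  from `B12EdgeTreeLength257.treeLen_block_lt_edgeLen_block`).
* §8 (revision v1.1, append-only; §§1–7 byte-identical to v1.0 = p320347) — THE LINEAR COMPARISON for the length of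
  record: ℓ¹ ≤ d · sup gives `treeLen1 X ≤ d · treeLen X`, hence `edgeLen_le_mul_treeLen` (edgeLen X ≤ d · treeLen X)
  and `treeLen_le_edgeLen_le_mul_treeLen` (treeLen Y ≤ edgeLen Y ≤ d · treeLen Y for localization domains; d = 4:
  edgeLen ≤ 4 · d_j(Y), `edgeLen_le_four_mul_treeLen`), sharpening `B12EdgeTreeLength257.edgeLen_le_affine_treeLen`
  (4·2^d·treeLen + 2^d − 1); on the 3^d block edgeLen = 2^d − 1 and treeLen ≤ 2^(d−1) (`block_comparison`); no
  sharpness claim is made for the factor d.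
* §9 (revision v1.2, append-only; §§1–8 byte-identical to v1.1 = p321167) — THE THREE USUAL NORMS: the Euclidean
  linear size `treeLen2 X` (infimum of `B12EdgeTreeLength257.elen` over the admissible graphs), sup ≤ ℓ² ≤ ℓ¹ ≤ √d·ℓ²
  (`dist_le_edist2`, `edist2_le_dist1`, `dist1_le_sqrt_mul_edist2` by Cauchy–Schwarz), hence `three_norms`:
  treeLen X ≤ treeLen2 X ≤ treeLen1 X = edgeLen X, edgeLen X ≤ √d · treeLen2 X, edgeLen X ≤ d · treeLen X — the
  printed «equivalent definition» holds exactly for ℓ¹, up to the factor √d for the Euclidean length (strict on the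
  3 × 3 block: `treeLen2_block_two_lt_edgeLen`, from `B12EdgeTreeLength257.euclidean_separation_block_two`) and up to
  the factor d for the sup length of record.

HONEST SCOPE / READING NOTE (cell GAPS.md G-B12-08, DIVERGENCE D-T2).  (a) The print names no metric for «a length of
a … graph».  `TreeLength` fixed the SUP metric of [Dimock2013BalabanII] App. E as the length of record, and for that
functional (and for the Euclidean one) the sentence fails on the 3^d block (`B12EdgeTreeLength257` §6, §11).  The
present file shows that under the ℓ¹ length — the third usual norm, and the one for which «it is easy to see» by the
staircase-and-snapping argument above — the sentence holds EXACTLY and in every dimension: the two definitions of the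
linear size coincide (`treeLen1_eq_edgeLen`).  Which metric the author had in mind is not printed; this file records
the reading under which the printed remark is a theorem, next to the readings under which it is not, and makes no
further claim.  (b) Conventions (ii) of `TreeLength` apply verbatim (infima over connected finite unions of segments /
of cube edges rather than over tree graphs; the pruning to trees is not formalised).  (c) What the paper USES of
d_j(X) — the summability statements (0.26)–(0.27)/(4.36)/[II] (2.27)–(2.30) — is insensitive to the choice among
these bi-Lipschitz-equivalent lengths (κ adjusted; `B12EdgeTreeLength257.edgeLen_le_affine_treeLen`, §8 `edgeLen_le_mul_treeLen`), so nothing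
downstream depends on the reading.  (d) The proof route (anchors, staircases, entry/exit parameters, the tent slide,
the bad-level count) is ours; the print gives none.  Value = kernel-checked reading note on a printed sentence, NOT
summit progress.
-/

namespace Literature.MathematicalPhysics.QuantumFieldTheory.Balaban1983to89.B12EdgeTreeLength257L1

noncomputable section

open Literature.MathematicalPhysics.QuantumFieldTheory.Balaban1983to89
open Literature.MathematicalPhysics.QuantumFieldTheory.Balaban1983to89.B13ScaleTransfer
open Literature.MathematicalPhysics.QuantumFieldTheory.Balaban1983to89.TreeLength
open Literature.MathematicalPhysics.QuantumFieldTheory.Balaban1983to89.B12EdgeTreeLength257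
open Literature.MathematicalPhysics.QuantumFieldTheory.Balaban1983to89.B12ShortestGraph257
open _root_.Topology Relation

variable {d : ℕ}

/-! ## §1. The ℓ¹ length of a polygonal graph and the ℓ¹ linear size `treeLen1` -/

/-- The ℓ¹ distance of two points of ℝ^d. [cite: Balaban1987RG1, p.257 (linear size d_j, edges of cubes)] -/
def dist1 (p q : RPt d) : ℝ := ∑ i, |p i - q i|

/-- The ℓ¹ LENGTH of a polygonal graph: the sum of the ℓ¹ lengths of its segments. [cite: Balaban1987RG1, p.257 (linear size d_j, edges of cubes)] -/
def len1 : List (Seg d) → ℝ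
  | [] => 0
  | s :: T => dist1 s.1 s.2 + len1 T

/-- ℓ¹ length of the empty graph. [cite: Balaban1987RG1, p.257 (linear size d_j, edges of cubes)] -/
@[simp] theorem len1_nil : len1 ([] : List (Seg d)) = 0 := rfl

/-- ℓ¹ length of a graph with one more segment. [cite: Balaban1987RG1, p.257 (linear size d_j, edges of cubes)] -/
@[simp] theorem len1_cons (s : Seg d) (T : List (Seg d)) : len1 (s :: T) = dist1 s.1 s.2 + len1 T := rfl

/-- The ℓ¹ distance is non-negative. [cite: Balaban1987RG1, p.257 (linear size d_j, edges of cubes)] -/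
theorem dist1_nonneg (p q : RPt d) : 0 ≤ dist1 p q := Finset.sum_nonneg fun _ _ => abs_nonneg _

/-- The ℓ¹ distance is symmetric. [cite: Balaban1987RG1, p.257 (linear size d_j, edges of cubes)] -/
theorem dist1_comm (p q : RPt d) : dist1 p q = dist1 q p :=
  Finset.sum_congr rfl fun _ _ => abs_sub_comm _ _

/-- The ℓ¹ distance of a point to itself vanishes. [cite: Balaban1987RG1, p.257 (linear size d_j, edges of cubes)] -/
@[simp] theorem dist1_self (p : RPt d) : dist1 p p = 0 := by simp [dist1]

/-- The sup distance is at most the ℓ¹ distance. [cite: Balaban1987RG1, p.257 (linear size d_j, edges of cubes)] -/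
theorem dist_le_dist1 (p q : RPt d) : dist p q ≤ dist1 p q := by
  rw [dist_pi_le_iff (dist1_nonneg p q)]
  intro i
  rw [Real.dist_eq]
  exact Finset.single_le_sum (f := fun j => |p j - q j|) (fun j _ => abs_nonneg _) (Finset.mem_univ i)

/-- ℓ¹ length of a concatenation. [cite: Balaban1987RG1, p.257 (linear size d_j, edges of cubes)] -/
theorem len1_append (T T' : List (Seg d)) : len1 (T ++ T') = len1 T + len1 T' := by
  induction T with
  | nil => simp
  | cons s T ih => simp [ih, add_assoc]

/-- ℓ¹ lengths are non-negative. [cite: Balaban1987RG1, p.257 (linear size d_j, edges of cubes)] -/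
theorem len1_nonneg (T : List (Seg d)) : 0 ≤ len1 T := by
  induction T with
  | nil => simp
  | cons s T ih => rw [len1_cons]; exact add_nonneg (dist1_nonneg _ _) ih

/-- ℓ¹ length as a list sum. [cite: Balaban1987RG1, p.257 (linear size d_j, edges of cubes)] -/
theorem len1_eq_sum_map (T : List (Seg d)) : len1 T = (T.map fun s => dist1 s.1 s.2).sum := by
  induction T with
  | nil => simp
  | cons s T ih => simp [ih]

/-- ℓ¹ length of a concatenation of graphs. [cite: Balaban1987RG1, p.257 (linear size d_j, edges of cubes)] -/
theorem len1_flatten : ∀ (G : List (List (Seg d))), len1 G.flatten = (G.map len1).sum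
  | [] => by simp
  | g :: G => by rw [List.flatten_cons, len1_append, len1_flatten G, List.map_cons, List.sum_cons]

/-- The set of ℓ¹ lengths of the admissible graphs for X. [cite: Balaban1987RG1, p.257 (linear size d_j, edges of cubes)] -/
def lengths1 (X : Finset (Pt d)) : Set ℝ := {ℓ | ∃ T, Admissible X T ∧ len1 T = ℓ}

/-- THE ℓ¹ LINEAR SIZE: the infimum of the ℓ¹ lengths of the admissible graphs for X (the ℓ¹ reading of «a length of
a shortest graph in this class», cf. `TreeLength.treeLen` for the sup-metric reading of record). [cite: Balaban1987RG1, p.257 (linear size d_j, edges of cubes)] -/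
def treeLen1 (X : Finset (Pt d)) : ℝ := sInf (lengths1 X)

/-- `lengths1 X` is bounded below by 0. [cite: Balaban1987RG1, p.257 (linear size d_j, edges of cubes)] -/
theorem bddBelow_lengths1 (X : Finset (Pt d)) : BddBelow (lengths1 X) :=
  ⟨0, by rintro _ ⟨T, -, rfl⟩; exact len1_nonneg T⟩

/-- The ℓ¹ linear size is at most the ℓ¹ length of any admissible graph. [cite: Balaban1987RG1, p.257 (linear size d_j, edges of cubes)] -/
theorem treeLen1_le_len1 {X : Finset (Pt d)} {T : List (Seg d)} (h : Admissible X T) : treeLen1 X ≤ len1 T :=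
  csInf_le (bddBelow_lengths1 X) ⟨T, h, rfl⟩

/-- A lower bound of all admissible ℓ¹ lengths bounds the ℓ¹ linear size from below. [cite: Balaban1987RG1, p.257 (linear size d_j, edges of cubes)] -/
theorem le_treeLen1 {X : Finset (Pt d)} {a : ℝ} (hne : ∃ T, Admissible X T)
    (h : ∀ T, Admissible X T → a ≤ len1 T) : a ≤ treeLen1 X := by
  obtain ⟨T₀, hT₀⟩ := hne
  refine le_csInf ⟨len1 T₀, T₀, hT₀, rfl⟩ ?_
  rintro _ ⟨T, hT, rfl⟩
  exact h T hT

/-- The sup-metric linear size is at most the ℓ¹ one. [cite: Balaban1987RG1, p.257 (linear size d_j, edges of cubes)] -/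
theorem treeLen_le_treeLen1 {X : Finset (Pt d)} (hne : ∃ T, Admissible X T) : treeLen X ≤ treeLen1 X := by
  refine le_treeLen1 hne fun T hT => (treeLen_le_len hT).trans ?_
  clear hT
  induction T with
  | nil => simp
  | cons s T ih => rw [len_cons, len1_cons]; exact add_le_add (dist_le_dist1 _ _) ih

/-- A UNIT EDGE HAS ℓ¹ LENGTH 1 (upward orientation). [cite: Balaban1987RG1, p.257 (linear size d_j, edges of cubes)] -/
theorem dist1_corner_of_isUpEdge {v w : Pt d} (h : IsUpEdge v w) : dist1 (corner v) (corner w) = 1 := by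
  obtain ⟨i, hi, hj⟩ := h.coord
  unfold dist1
  rw [Finset.sum_eq_single i]
  · simp only [corner, hi, Int.cast_add, Int.cast_one]
    norm_num
  · intro j _ hji
    simp only [corner, hj j hji, sub_self, abs_zero]
  · intro hi'
    exact absurd (Finset.mem_univ i) hi'

/-- The ℓ¹ length of the segment of a lattice pair: 0 for a vertex, 1 for a unit edge. [cite: Balaban1987RG1, p.257 (linear size d_j, edges of cubes)] -/
theorem dist1_seg_of_isLatticePair {v w : Pt d} (h : IsLatticePair v w) :
    dist1 (corner v) (corner w) = if v = w then 0 else 1 := by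
  split_ifs with hvw
  · subst hvw; simp
  · rcases h with h | h
    · exact absurd h hvw
    · rcases adj_iff_isUpEdge.1 h with h | h
      · exact dist1_corner_of_isUpEdge h
      · rw [dist1_comm]; exact dist1_corner_of_isUpEdge h

/-- THE ℓ¹ LENGTH OF AN EDGE GRAPH IS ITS NUMBER OF UNIT EDGES. [cite: Balaban1987RG1, p.257 (linear size d_j, edges of cubes)] -/
theorem len1_toSegs {E : List (Pt d × Pt d)} (h : ∀ e ∈ E, IsLatticePair e.1 e.2) :
    len1 (toSegs E) = (nedges E : ℝ) := by
  induction E with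
  | nil => simp [toSegs, nedges]
  | cons e E ih =>
    rw [toSegs_cons, len1_cons, nedges_cons, ih fun e' he' => h e' (List.mem_cons_of_mem _ he')]
    rw [show (corner e.1, corner e.2).1 = corner e.1 from rfl, show (corner e.1, corner e.2).2 = corner e.2 from rfl,
      dist1_seg_of_isLatticePair (h e List.mem_cons_self)]
    split_ifs <;> push_cast <;> ring

/-- The ℓ¹ linear size is at most the edge length (edge graphs are admissible and have ℓ¹ length = their number
of unit edges). [cite: Balaban1987RG1, p.257 (linear size d_j, edges of cubes)] -/
theorem treeLen1_le_edgeLen {X : Finset (Pt d)} (hne : ∃ E, EAdmissible X E) :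
    treeLen1 X ≤ (edgeLen X : ℝ) := by
  obtain ⟨E, hE, hn⟩ := exists_eAdmissible_nedges_eq hne
  rw [← hn, ← len1_toSegs hE.lattice]
  exact treeLen1_le_len1 hE.admissible

/-! ## §2. Rectilinear graphs with lattice endpoints are edge graphs: `edgeLen ≤ len1` for them -/

/-- A segment is AXIS-PARALLEL if its endpoints differ in at most one coordinate (degenerate segments included).
[cite: Balaban1987RG1, p.257 (linear size d_j, edges of cubes)] -/
def AxisParallel (s : Seg d) : Prop := ∀ j k : Fin d, s.1 j ≠ s.2 j → s.1 k ≠ s.2 k → j = k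

/-- A RECTILINEAR graph: all segments axis-parallel. [cite: Balaban1987RG1, p.257 (linear size d_j, edges of cubes)] -/
def Rectilinear (T : List (Seg d)) : Prop := ∀ s ∈ T, AxisParallel s

/-- A point of ℝ^d with integer coordinates. [cite: Balaban1987RG1, p.257 (linear size d_j, edges of cubes)] -/
def IsLatticePt (p : RPt d) : Prop := ∃ v : Pt d, p = corner v

/-- All endpoints of the graph are lattice points. [cite: Balaban1987RG1, p.257 (linear size d_j, edges of cubes)] -/
def LatticeEnds (T : List (Seg d)) : Prop := ∀ s ∈ T, IsLatticePt s.1 ∧ IsLatticePt s.2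

/-- The unit coordinate vector e_i of ℤ^d scaled: the lattice point v + k·e_i. [cite: Balaban1987RG1, p.257 (linear size d_j, edges of cubes)] -/
def shiftPt (v : Pt d) (i : Fin d) (k : ℤ) : Pt d := Function.update v i (v i + k)

/-- `shiftPt v i 0 = v`. [cite: Balaban1987RG1, p.257 (linear size d_j, edges of cubes)] -/
@[simp] theorem shiftPt_zero (v : Pt d) (i : Fin d) : shiftPt v i 0 = v := by
  simp [shiftPt]

/-- Consecutive shifted points form an upward unit edge. [cite: Balaban1987RG1, p.257 (linear size d_j, edges of cubes)] -/
theorem isUpEdge_shiftPt (v : Pt d) (i : Fin d) (k : ℤ) : IsUpEdge (shiftPt v i k) (shiftPt v i (k + 1)) := by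
  refine ⟨i, ?_⟩
  ext j
  by_cases hj : j = i
  · subst hj; simp [shiftPt]; ring
  · simp [shiftPt, hj]

/-- The corner of a shifted point: `corner (shiftPt v i k) = corner v + k • e_i`. [cite: Balaban1987RG1, p.257 (linear size d_j, edges of cubes)] -/
theorem corner_shiftPt (v : Pt d) (i : Fin d) (k : ℤ) :
    corner (shiftPt v i k) = Function.update (corner v) i ((v i : ℝ) + k) := by
  ext j
  by_cases hj : j = i
  · subst hj; simp [corner, shiftPt]
  · simp [corner, shiftPt, hj]

/-- The UNIT-EDGE CHAIN from v along e_i: the m pairs (v + k e_i, v + (k+1) e_i), k < m. [cite: Balaban1987RG1, p.257 (linear size d_j, edges of cubes)] -/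
def edgeChain (v : Pt d) (i : Fin d) : ℕ → List (Pt d × Pt d)
  | 0 => []
  | m + 1 => edgeChain v i m ++ [(shiftPt v i m, shiftPt v i (m + 1))]

/-- The unit-edge chain has m unit edges. [cite: Balaban1987RG1, p.257 (linear size d_j, edges of cubes)] -/
theorem nedges_edgeChain (v : Pt d) (i : Fin d) : ∀ m : ℕ, nedges (edgeChain v i m) = m
  | 0 => rfl
  | m + 1 => by
      rw [edgeChain]
      unfold nedges
      rw [List.filter_append, List.length_append]
      have h1 := nedges_edgeChain v i m
      unfold nedges at h1
      rw [h1]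
      have hne : shiftPt v i (m : ℤ) ≠ shiftPt v i ((m : ℤ) + 1) := (isUpEdge_shiftPt v i m).ne
      simp [hne]

/-- Members of the unit-edge chain are upward unit edges (v + k e_i, v + (k+1) e_i) with k < m. [cite: Balaban1987RG1, p.257 (linear size d_j, edges of cubes)] -/
theorem mem_edgeChain {v : Pt d} {i : Fin d} : ∀ {m : ℕ} {e : Pt d × Pt d}, e ∈ edgeChain v i m →
    ∃ k : ℕ, k < m ∧ e = (shiftPt v i k, shiftPt v i (k + 1))
  | 0, e, h => by simp [edgeChain] at h
  | m + 1, e, h => by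
      rw [edgeChain, List.mem_append, List.mem_singleton] at h
      rcases h with h | rfl
      · obtain ⟨k, hk, rfl⟩ := mem_edgeChain h
        exact ⟨k, by omega, rfl⟩
      · exact ⟨m, by omega, rfl⟩

/-- The point of the axis line through `corner v` in direction e_i at height θ. [cite: Balaban1987RG1, p.257 (linear size d_j, edges of cubes)] -/
def axisPt (v : Pt d) (i : Fin d) (θ : ℝ) : RPt d := Function.update (corner v) i ((v i : ℝ) + θ)

/-- `corner (shiftPt v i k) = axisPt v i k`. [cite: Balaban1987RG1, p.257 (linear size d_j, edges of cubes)] -/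
theorem corner_shiftPt_eq_axisPt (v : Pt d) (i : Fin d) (k : ℤ) : corner (shiftPt v i k) = axisPt v i k :=
  corner_shiftPt v i k

/-- AXIS SEGMENTS: the segment between two points of an axis line consists of the axis points at intermediate
heights. [cite: Balaban1987RG1, p.257 (linear size d_j, edges of cubes)] -/
theorem segment_axisPt (v : Pt d) (i : Fin d) (θ₁ θ₂ : ℝ) :
    segment ℝ (axisPt v i θ₁) (axisPt v i θ₂) = axisPt v i '' Set.uIcc θ₁ θ₂ := by
  rw [segment_eq_image', ← segment_eq_uIcc, segment_eq_image']
  ext p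
  simp only [Set.mem_image, Set.mem_Icc]
  constructor
  · rintro ⟨t, ht, rfl⟩
    refine ⟨θ₁ + t • (θ₂ - θ₁), ⟨t, ht, rfl⟩, ?_⟩
    ext j
    by_cases hj : j = i
    · subst hj; simp [axisPt]; ring
    · simp [axisPt, hj]
  · rintro ⟨θ, ⟨t, ht, rfl⟩, rfl⟩
    refine ⟨t, ht, ?_⟩
    ext j
    by_cases hj : j = i
    · subst hj; simp [axisPt]; ring
    · simp [axisPt, hj]

/-- The carrier of the unit-edge chain of length m is the axis segment from height 0 to height m. [cite: Balaban1987RG1, p.257 (linear size d_j, edges of cubes)] -/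
theorem carrier_toSegs_edgeChain (v : Pt d) (i : Fin d) : ∀ m : ℕ, 0 < m →
    carrier (toSegs (edgeChain v i m)) = axisPt v i '' Set.Icc (0 : ℝ) m
  | 0, h => (lt_irrefl 0 h).elim
  | m + 1, _ => by
      rw [edgeChain, toSegs, List.map_append, ← toSegs, carrier_append]
      simp only [List.map_cons, List.map_nil, carrier_cons, carrier_nil, Set.union_empty, seg,
        corner_shiftPt_eq_axisPt]
      rw [segment_axisPt]
      rcases Nat.eq_zero_or_pos m with rfl | hm
      · simp [edgeChain, toSegs]
      · rw [carrier_toSegs_edgeChain v i m hm, ← Set.image_union]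
        congr 1
        push_cast
        rw [Set.uIcc_of_le (by linarith : (m : ℝ) ≤ m + 1)]
        exact Set.Icc_union_Icc_eq_Icc (by positivity) (by linarith)

/-- The edge chain realising an axis-parallel lattice segment: from `corner v` to `corner w` where w = v + m e_i
(m ≥ 0), or the vertex pair (v, v) when v = w. [cite: Balaban1987RG1, p.257 (linear size d_j, edges of cubes)] -/
theorem exists_edgeChain_of_lattice_axisParallel {v w : Pt d} (h : AxisParallel (corner v, corner w)) :
    ∃ E : List (Pt d × Pt d), (∀ e ∈ E, IsUpEdge e.1 e.2 ∨ e.1 = e.2) ∧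
      carrier (toSegs E) = segment ℝ (corner v) (corner w) ∧ (nedges E : ℝ) = dist1 (corner v) (corner w) := by
  classical
  by_cases hvw : v = w
  · subst hvw
    refine ⟨[(v, v)], by simp, ?_, ?_⟩
    · simp [toSegs, seg]
    · simp [nedges]
  · -- the unique coordinate where v and w differ
    have hex : ∃ i, v i ≠ w i := by
      by_contra hcon
      push Not at hcon
      exact hvw (funext hcon)
    obtain ⟨i, hi⟩ := hex
    have hj : ∀ j, j ≠ i → v j = w j := by
      intro j hji
      by_contra hne
      have h1 : (corner v, corner w).1 j ≠ (corner v, corner w).2 j := by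
        simpa [corner] using hne
      have h2 : (corner v, corner w).1 i ≠ (corner v, corner w).2 i := by
        simpa [corner] using hi
      exact hji (h j i h1 h2)
    -- orient: the lower endpoint u and m = |w i - v i|
    obtain ⟨u, u', hu, hu', hlt⟩ : ∃ u u' : Pt d, ({u, u'} : Set (Pt d)) = {v, w} ∧ (∀ j, j ≠ i → u j = u' j) ∧
        u i < u' i := by
      rcases lt_or_gt_of_ne hi with hlt | hlt
      · exact ⟨v, w, rfl, hj, hlt⟩
      · exact ⟨w, v, Set.pair_comm _ _, fun j hji => (hj j hji).symm, hlt⟩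
    set m : ℕ := (u' i - u i).toNat with hm
    have hmpos : 0 < m := by omega
    have hm' : (m : ℤ) = u' i - u i := by omega
    have hu'eq : u' = shiftPt u i m := by
      ext j
      by_cases hji : j = i
      · subst hji; simp [shiftPt, hm']
      · simp [shiftPt, hji, hu' j hji]
    refine ⟨edgeChain u i m, ?_, ?_, ?_⟩
    · intro e he
      obtain ⟨k, -, rfl⟩ := mem_edgeChain he
      exact Or.inl (by exact_mod_cast isUpEdge_shiftPt u i k)
    · rw [carrier_toSegs_edgeChain u i m hmpos]
      have hseg : segment ℝ (corner v) (corner w) = segment ℝ (corner u) (corner u') := by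
        have : ({corner u, corner u'} : Set (RPt d)) = {corner v, corner w} := by
          rw [← Set.image_pair, hu, Set.image_pair]
        rcases Set.pair_eq_pair_iff.1 this with ⟨h1, h2⟩ | ⟨h1, h2⟩
        · rw [h1, h2]
        · rw [h1, h2, segment_symm]
      rw [hseg, hu'eq, corner_shiftPt_eq_axisPt]
      have h0 : corner u = axisPt u i 0 := by
        ext j; by_cases hji : j = i
        · subst hji; simp [axisPt, corner]
        · simp [axisPt, corner, hji]
      rw [h0, segment_axisPt, Set.uIcc_of_le (by positivity)]
      norm_cast
    · rw [nedges_edgeChain]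
      have hdist : dist1 (corner v) (corner w) = dist1 (corner u) (corner u') := by
        have : ({corner u, corner u'} : Set (RPt d)) = {corner v, corner w} := by
          rw [← Set.image_pair, hu, Set.image_pair]
        rcases Set.pair_eq_pair_iff.1 this with ⟨h1, h2⟩ | ⟨h1, h2⟩
        · rw [h1, h2]
        · rw [h1, h2, dist1_comm]
      rw [hdist]
      unfold dist1
      rw [Finset.sum_eq_single i]
      · simp only [corner]
        rw [abs_sub_comm, abs_of_pos (by exact_mod_cast sub_pos.2 hlt)]
        exact_mod_cast hm'
      · intro j _ hji
        simp [corner, hu' j hji]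
      · intro hi'; exact absurd (Finset.mem_univ i) hi'

/-- A unit edge or vertex pair whose segment lies in the cubes of X consists of vertices of ONE cube of X (the
cube containing the midpoint of the edge). [cite: Balaban1987RG1, p.257 (linear size d_j, edges of cubes)] -/
theorem exists_ofCube {X : Finset (Pt d)} {e : Pt d × Pt d} (he : IsUpEdge e.1 e.2 ∨ e.1 = e.2)
    (hsub : segment ℝ (corner e.1) (corner e.2) ⊆ cubes X) : ∃ x ∈ X, IsVertex x e.1 ∧ IsVertex x e.2 := by
  rcases he with he | he
  · obtain ⟨i, hi, hj⟩ := he.coord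
    -- midpoint
    set μ : RPt d := midpoint ℝ (corner e.1) (corner e.2) with hμ
    have hμmem : μ ∈ segment ℝ (corner e.1) (corner e.2) := midpoint_mem_segment _ _
    obtain ⟨x, hx, hμx⟩ := mem_cubes.1 (hsub hμmem)
    refine ⟨x, hx, ?_, ?_⟩
    · intro j
      obtain ⟨h1, h2⟩ := mem_cube.1 hμx j
      by_cases hji : j = i
      · subst hji
        have : μ j = (e.1 j : ℝ) + 1 / 2 := by
          rw [hμ, midpoint_eq_smul_add]
          simp [corner, hi]; ring
        rw [this] at h1 h2
        left
        have h3 : (x j : ℝ) - 1 / 2 ≤ e.1 j := by linarith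
        have h4 : (e.1 j : ℝ) ≤ x j + 1 / 2 := by linarith
        have h5 : x j - 1 < e.1 j := by exact_mod_cast (by linarith : (x j : ℝ) - 1 < e.1 j)
        have h6 : e.1 j < x j + 1 := by exact_mod_cast (by linarith : (e.1 j : ℝ) < x j + 1)
        omega
      · have : μ j = (e.1 j : ℝ) := by
          rw [hμ, midpoint_eq_smul_add]
          simp [corner, hj j hji]; ring
        rw [this] at h1 h2
        have h1' : x j ≤ e.1 j := by exact_mod_cast h1
        have h2' : e.1 j ≤ x j + 1 := by exact_mod_cast h2
        omega
    · intro j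
      obtain ⟨h1, h2⟩ := mem_cube.1 hμx j
      by_cases hji : j = i
      · subst hji
        have : μ j = (e.1 j : ℝ) + 1 / 2 := by
          rw [hμ, midpoint_eq_smul_add]
          simp [corner, hi]; ring
        rw [this] at h1 h2
        right
        rw [hi]
        have h5 : x j - 1 < e.1 j := by exact_mod_cast (by linarith : (x j : ℝ) - 1 < e.1 j)
        have h6 : e.1 j < x j + 1 := by exact_mod_cast (by linarith : (e.1 j : ℝ) < x j + 1)
        omega
      · have : μ j = (e.1 j : ℝ) := by
          rw [hμ, midpoint_eq_smul_add]
          simp [corner, hj j hji]; ring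
        rw [this] at h1 h2
        rw [hj j hji]
        have h1' : x j ≤ e.1 j := by exact_mod_cast h1
        have h2' : e.1 j ≤ x j + 1 := by exact_mod_cast h2
        omega
  · have hmem : corner e.1 ∈ cubes X := hsub (left_mem_segment ℝ _ _)
    obtain ⟨x, hx, h1⟩ := mem_cubes.1 hmem
    exact ⟨x, hx, isVertex_of_corner_mem_cube h1, he ▸ isVertex_of_corner_mem_cube h1⟩

/-- `nedges` is additive over concatenation. [cite: Balaban1987RG1, p.257 (linear size d_j, edges of cubes)] -/
theorem nedges_append (E E' : List (Pt d × Pt d)) : nedges (E ++ E') = nedges E + nedges E' := by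
  unfold nedges
  rw [List.filter_append, List.length_append]

/-- PHASE III — A RECTILINEAR ADMISSIBLE GRAPH WITH LATTICE ENDPOINTS IS AN EDGE GRAPH: it is realised by an
admissible edge graph with the same carrier whose number of unit edges is its ℓ¹ length; hence `edgeLen X ≤ len1 T`.
[cite: Balaban1987RG1, p.257 (linear size d_j, edges of cubes)] -/
theorem exists_eAdmissible_of_rectilinear_lattice {X : Finset (Pt d)} :
    ∀ (T : List (Seg d)), Rectilinear T → LatticeEnds T → (∀ s ∈ T, segment ℝ s.1 s.2 ⊆ cubes X) →
      ∃ E : List (Pt d × Pt d), (∀ e ∈ E, IsLatticePair e.1 e.2) ∧ (∀ e ∈ E, ∃ x ∈ X, IsVertex x e.1 ∧ IsVertex x e.2)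
        ∧ carrier (toSegs E) = carrier T ∧ (nedges E : ℝ) = len1 T
  | [], _, _, _ => ⟨[], by simp, by simp, by simp [toSegs], by simp [nedges]⟩
  | s :: T, hR, hL, hX => by
      obtain ⟨E, hE1, hE2, hE3, hE4⟩ := exists_eAdmissible_of_rectilinear_lattice T
        (fun s' hs' => hR s' (List.mem_cons_of_mem _ hs')) (fun s' hs' => hL s' (List.mem_cons_of_mem _ hs'))
        (fun s' hs' => hX s' (List.mem_cons_of_mem _ hs'))
      obtain ⟨⟨v, hv⟩, ⟨w, hw⟩⟩ := hL s List.mem_cons_self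
      have hap : AxisParallel (corner v, corner w) := by
        have := hR s List.mem_cons_self
        rwa [show s = (corner v, corner w) from Prod.ext hv hw] at this
      obtain ⟨E₀, hE₀1, hE₀2, hE₀3⟩ := exists_edgeChain_of_lattice_axisParallel hap
      have hsX : segment ℝ (corner v) (corner w) ⊆ cubes X := by
        have := hX s List.mem_cons_self
        rwa [hv, hw] at this
      refine ⟨E₀ ++ E, ?_, ?_, ?_, ?_⟩
      · intro e he
        rcases List.mem_append.1 he with he | he
        · rcases hE₀1 e he with h | h
          · exact Or.inr h.adj
          · exact Or.inl h
        · exact hE1 e he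
      · intro e he
        rcases List.mem_append.1 he with he | he
        · refine exists_ofCube (hE₀1 e he) ?_
          refine Set.Subset.trans ?_ hsX
          rw [← hE₀2]
          exact segment_subset_carrier (T := toSegs E₀) (s := seg e) (List.mem_map.2 ⟨e, he, rfl⟩)
        · exact hE2 e he
      · rw [toSegs, List.map_append, ← toSegs, ← toSegs, carrier_append, hE₀2, hE3, carrier_cons, hv, hw]
      · rw [nedges_append, Nat.cast_add, hE₀3, hE4, len1_cons, hv, hw]

/-- Hence: for a rectilinear admissible graph with lattice endpoints, `edgeLen X ≤ len1 T`. [cite: Balaban1987RG1, p.257 (linear size d_j, edges of cubes)] -/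
theorem edgeLen_le_len1_of_rectilinear_lattice {X : Finset (Pt d)} {T : List (Seg d)} (hT : Admissible X T)
    (hR : Rectilinear T) (hL : LatticeEnds T) : (edgeLen X : ℝ) ≤ len1 T := by
  obtain ⟨E, hE1, hE2, hE3, hE4⟩ := exists_eAdmissible_of_rectilinear_lattice T hR hL
    fun s hs => (segment_subset_carrier hs).trans hT.subset
  have hE : EAdmissible X E := ⟨hE1, hE2, ⟨by rw [hE3]; exact hT.connected, by rw [hE3]; exact hT.subset,
    by rw [hE3]; exact hT.meets⟩⟩
  rw [← hE4]
  exact_mod_cast edgeLen_le_nedges hE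

/-! ## §3. The sliding map: a monotone piecewise-linear move of one coordinate level -/

section Slide

variable {sm s sp : ℝ}

/-- The TENT profile: 0 up to s⁻, rising linearly to 1 at s, falling linearly to 0 at s⁺, 0 beyond. [cite: Balaban1987RG1, p.257 (linear size d_j, edges of cubes)] -/
def tent (sm s sp x : ℝ) : ℝ := max 0 (min ((x - sm) / (s - sm)) ((sp - x) / (sp - s)))

/-- The tent vanishes to the left of s⁻. [cite: Balaban1987RG1, p.257 (linear size d_j, edges of cubes)] -/
theorem tent_of_le_left (hsm : sm < s) {x : ℝ} (hx : x ≤ sm) : tent sm s sp x = 0 := by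
  unfold tent
  apply max_eq_left
  refine (min_le_left _ _).trans ?_
  exact div_nonpos_of_nonpos_of_nonneg (by linarith) (by linarith)

/-- The tent vanishes to the right of s⁺. [cite: Balaban1987RG1, p.257 (linear size d_j, edges of cubes)] -/
theorem tent_of_right_le (hsp : s < sp) {x : ℝ} (hx : sp ≤ x) : tent sm s sp x = 0 := by
  unfold tent
  apply max_eq_left
  refine (min_le_right _ _).trans ?_
  exact div_nonpos_of_nonpos_of_nonneg (by linarith) (by linarith)

/-- The tent has height 1 at s. [cite: Balaban1987RG1, p.257 (linear size d_j, edges of cubes)] -/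
theorem tent_self (hsm : sm < s) (hsp : s < sp) : tent sm s sp s = 1 := by
  unfold tent
  rw [div_self (by linarith : s - sm ≠ 0), div_self (by linarith : sp - s ≠ 0), min_self]
  exact max_eq_right zero_le_one

/-- The tent is continuous. [cite: Balaban1987RG1, p.257 (linear size d_j, edges of cubes)] -/
theorem continuous_tent (sm s sp : ℝ) : Continuous (tent sm s sp) := by
  unfold tent
  exact continuous_const.max (((continuous_id.sub continuous_const).div_const _).min
    ((continuous_const.sub continuous_id).div_const _))

/-- THE SLIDING MAP of one real coordinate: x ↦ x + t·tent(x) (moves the level s to s + t, fixes everything outside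
(s⁻, s⁺)). [cite: Balaban1987RG1, p.257 (linear size d_j, edges of cubes)] -/
def fmove (sm s sp t x : ℝ) : ℝ := x + t * tent sm s sp x

/-- The sliding map fixes points left of s⁻. [cite: Balaban1987RG1, p.257 (linear size d_j, edges of cubes)] -/
theorem fmove_of_le_left (hsm : sm < s) {t x : ℝ} (hx : x ≤ sm) : fmove sm s sp t x = x := by
  rw [fmove, tent_of_le_left hsm hx, mul_zero, add_zero]

/-- The sliding map fixes points right of s⁺. [cite: Balaban1987RG1, p.257 (linear size d_j, edges of cubes)] -/
theorem fmove_of_right_le (hsp : s < sp) {t x : ℝ} (hx : sp ≤ x) : fmove sm s sp t x = x := by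
  rw [fmove, tent_of_right_le hsp hx, mul_zero, add_zero]

/-- The sliding map moves s to s + t. [cite: Balaban1987RG1, p.257 (linear size d_j, edges of cubes)] -/
theorem fmove_self (hsm : sm < s) (hsp : s < sp) (t : ℝ) : fmove sm s sp t s = s + t := by
  rw [fmove, tent_self hsm hsp, mul_one]

/-- The sliding map is continuous. [cite: Balaban1987RG1, p.257 (linear size d_j, edges of cubes)] -/
theorem continuous_fmove (sm s sp t : ℝ) : Continuous (fmove sm s sp t) :=
  continuous_id.add (continuous_const.mul (continuous_tent sm s sp))

/-- THE SLIDING MAP IS MONOTONE for shifts t ∈ [s⁻ − s, s⁺ − s] (on each linear piece its slope is ≥ 0). [cite: Balaban1987RG1, p.257 (linear size d_j, edges of cubes)] -/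
theorem monotone_fmove (hsm : sm < s) (hsp : s < sp) {t : ℝ} (ht1 : sm - s ≤ t) (ht2 : t ≤ sp - s) :
    Monotone (fmove sm s sp t) := by
  have hd1 : 0 < s - sm := by linarith
  have hd2 : 0 < sp - s := by linarith
  -- the two affine pieces
  have hg1 : Monotone fun x : ℝ => x + t * ((x - sm) / (s - sm)) := by
    intro x y hxy
    have : (x + t * ((x - sm) / (s - sm))) - (y + t * ((y - sm) / (s - sm))) =
        (x - y) * (1 + t / (s - sm)) := by
      field_simp
      ring
    have h2 : 0 ≤ 1 + t / (s - sm) := by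
      rw [← div_self (ne_of_gt hd1), ← add_div]
      exact div_nonneg (by linarith) hd1.le
    nlinarith
  have hg2 : Monotone fun x : ℝ => x + t * ((sp - x) / (sp - s)) := by
    intro x y hxy
    have : (x + t * ((sp - x) / (sp - s))) - (y + t * ((sp - y) / (sp - s))) =
        (x - y) * (1 - t / (sp - s)) := by
      field_simp
      ring
    have h2 : 0 ≤ 1 - t / (sp - s) := by
      rw [← div_self (ne_of_gt hd2), ← sub_div]
      exact div_nonneg (by linarith) hd2.le
    nlinarith
  rcases le_total 0 t with ht | ht
  · have heq : fmove sm s sp t = fun x => max x (min (x + t * ((x - sm) / (s - sm))) (x + t * ((sp - x) / (sp - s)))) := by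
      funext x
      have e1 : t * max 0 (min ((x - sm) / (s - sm)) ((sp - x) / (sp - s))) =
          max (t * 0) (t * min ((x - sm) / (s - sm)) ((sp - x) / (sp - s))) := (monotone_mul_left_of_nonneg ht).map_max
      have e2 : t * min ((x - sm) / (s - sm)) ((sp - x) / (sp - s)) =
          min (t * ((x - sm) / (s - sm))) (t * ((sp - x) / (sp - s))) := (monotone_mul_left_of_nonneg ht).map_min
      rw [fmove, tent, e1, e2, mul_zero, ← max_add_add_left, add_zero, ← min_add_add_left]
    rw [heq]
    exact monotone_id.max (hg1.min hg2)
  · have heq : fmove sm s sp t = fun x => min x (max (x + t * ((x - sm) / (s - sm))) (x + t * ((sp - x) / (sp - s)))) := by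
      funext x
      have e1 : t * max 0 (min ((x - sm) / (s - sm)) ((sp - x) / (sp - s))) =
          min (t * 0) (t * min ((x - sm) / (s - sm)) ((sp - x) / (sp - s))) := (antitone_mul_left ht).map_max
      have e2 : t * min ((x - sm) / (s - sm)) ((sp - x) / (sp - s)) =
          max (t * ((x - sm) / (s - sm))) (t * ((sp - x) / (sp - s))) := (antitone_mul_left ht).map_min
      rw [fmove, tent, e1, e2, mul_zero, ← min_add_add_left, add_zero, ← max_add_add_left]
    rw [heq]
    exact monotone_id.min (hg1.max hg2)

/-- The sliding map preserves every unit interval [m, m+1] of the line, provided no integer lies strictly between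
s⁻ and s⁺. [cite: Balaban1987RG1, p.257 (linear size d_j, edges of cubes)] -/
theorem fmove_mem_Icc (hsm : sm < s) (hsp : s < sp) {t : ℝ} (ht1 : sm - s ≤ t) (ht2 : t ≤ sp - s)
    (hgap : ∀ z : ℤ, (z : ℝ) ≤ sm ∨ sp ≤ z) {m : ℤ} {x : ℝ} (hx1 : (m : ℝ) ≤ x) (hx2 : x ≤ m + 1) :
    (m : ℝ) ≤ fmove sm s sp t x ∧ fmove sm s sp t x ≤ m + 1 := by
  by_cases h1 : x ≤ sm
  · rw [fmove_of_le_left hsm h1]; exact ⟨hx1, hx2⟩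
  by_cases h2 : sp ≤ x
  · rw [fmove_of_right_le hsp h2]; exact ⟨hx1, hx2⟩
  push Not at h1 h2
  have hm1 : (m : ℝ) ≤ sm := by
    rcases hgap m with h | h
    · exact h
    · linarith
  have hm2 : sp ≤ (m : ℝ) + 1 := by
    rcases hgap (m + 1) with h | h
    · push_cast at h; linarith
    · push_cast at h; exact h
  have hmono := monotone_fmove (sp := sp) hsm hsp ht1 ht2
  constructor
  · have := hmono h1.le
    rw [fmove_of_le_left hsm le_rfl] at this
    linarith
  · have := hmono h2.le
    rw [fmove_of_right_le hsp le_rfl] at this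
    linarith

/-- Levels: a value λ ≠ s is a LEVEL if it lies outside (s⁻, s⁺); the sliding map fixes levels. [cite: Balaban1987RG1, p.257 (linear size d_j, edges of cubes)] -/
theorem fmove_of_level (hsm : sm < s) (hsp : s < sp) {t lam : ℝ} (h : lam ≤ sm ∨ sp ≤ lam) :
    fmove sm s sp t lam = lam := by
  rcases h with h | h
  · exact fmove_of_le_left hsm h
  · exact fmove_of_right_le hsp h

/-- The signed indicator used in the length bookkeeping: +1 below s, −1 above s, 0 at s. [cite: Balaban1987RG1, p.257 (linear size d_j, edges of cubes)] -/
def sgnLevel (s x : ℝ) : ℝ := if x < s then 1 else if s < x then -1 else 0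

/-- The LENGTH SLOPE of a pair of levels (a, b) under the sliding of the level s. [cite: Balaban1987RG1, p.257 (linear size d_j, edges of cubes)] -/
def eps (s a b : ℝ) : ℝ := (if a = s then sgnLevel s b else 0) + (if b = s then sgnLevel s a else 0)

/-- AFFINE LENGTH BOOKKEEPING on the line: for two levels a, b (each = s or outside (s⁻, s⁺)) and a shift t in
[s⁻ − s, s⁺ − s], |f_t(a) − f_t(b)| = |a − b| + t·eps(a,b). [cite: Balaban1987RG1, p.257 (linear size d_j, edges of cubes)] -/
theorem abs_fmove_sub_fmove (hsm : sm < s) (hsp : s < sp) {t : ℝ} (ht1 : sm - s ≤ t) (ht2 : t ≤ sp - s)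
    {a b : ℝ} (ha : a = s ∨ a ≤ sm ∨ sp ≤ a) (hb : b = s ∨ b ≤ sm ∨ sp ≤ b) :
    |fmove sm s sp t a - fmove sm s sp t b| = |a - b| + t * eps s a b := by
  unfold eps sgnLevel
  rcases ha with rfl | ha
  · rw [fmove_self hsm hsp]
    rcases hb with rfl | hb
    · rw [fmove_self hsm hsp]
      simp
    · rw [fmove_of_level hsm hsp hb, if_pos rfl]
      have hbs : b ≠ a := by rintro rfl; rcases hb with hb | hb <;> linarith
      rw [if_neg hbs]
      rcases hb with hb | hb
      · have hlt : b < a := by linarith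
        rw [if_pos hlt, abs_of_nonneg (by linarith), abs_of_pos (by linarith)]
        ring
      · have hlt : a < b := by linarith
        rw [if_neg (not_lt.2 hlt.le), if_pos hlt, abs_of_nonpos (by linarith), abs_of_neg (by linarith)]
        ring
  · rw [fmove_of_level hsm hsp ha]
    have has : a ≠ s := by rintro rfl; rcases ha with ha | ha <;> linarith
    rw [if_neg has]
    rcases hb with rfl | hb
    · rw [fmove_self hsm hsp, if_pos rfl]
      rcases ha with ha | ha
      · have hlt : a < b := by linarith
        rw [if_pos hlt, abs_of_nonpos (by linarith), abs_of_neg (by linarith)]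
        ring
      · have hlt : b < a := by linarith
        rw [if_neg (not_lt.2 hlt.le), if_pos hlt, abs_of_nonneg (by linarith), abs_of_pos (by linarith)]
        ring
    · rw [fmove_of_level hsm hsp hb]
      have hbs : b ≠ s := by rintro rfl; rcases hb with hb | hb <;> linarith
      rw [if_neg hbs]
      ring

end Slide

/-! ## §4. The sliding map on ℝ^d, images of axis-parallel segments, and the snapping step -/

/-- The sliding map applied to coordinate i of ℝ^d. [cite: Balaban1987RG1, p.257 (linear size d_j, edges of cubes)] -/
def Fmove (i : Fin d) (sm s sp t : ℝ) (p : RPt d) : RPt d := Function.update p i (fmove sm s sp t (p i))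

/-- Coordinates of the sliding map. [cite: Balaban1987RG1, p.257 (linear size d_j, edges of cubes)] -/
theorem Fmove_apply (i : Fin d) (sm s sp t : ℝ) (p : RPt d) (j : Fin d) :
    Fmove i sm s sp t p j = if j = i then fmove sm s sp t (p i) else p j := by
  unfold Fmove
  by_cases hj : j = i
  · subst hj; simp
  · simp [hj]

/-- The sliding map on ℝ^d is continuous. [cite: Balaban1987RG1, p.257 (linear size d_j, edges of cubes)] -/
theorem continuous_Fmove (i : Fin d) (sm s sp t : ℝ) : Continuous (Fmove (d := d) i sm s sp t) := by
  refine continuous_pi fun j => ?_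
  simp only [Fmove_apply]
  by_cases hj : j = i
  · simp only [hj, if_true]
    exact (continuous_fmove sm s sp t).comp (continuous_apply i)
  · simp only [hj, if_false]
    exact continuous_apply j

/-- Segments between two points that differ only in coordinate i are images of real intervals under
`Function.update p i`. [cite: Balaban1987RG1, p.257 (linear size d_j, edges of cubes)] -/
theorem segment_update (p : RPt d) (i : Fin d) (y₁ y₂ : ℝ) :
    segment ℝ (Function.update p i y₁) (Function.update p i y₂) = Function.update p i '' Set.uIcc y₁ y₂ := by
  rw [segment_eq_image', ← segment_eq_uIcc, segment_eq_image']
  ext q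
  simp only [Set.mem_image, Set.mem_Icc]
  constructor
  · rintro ⟨θ, hθ, rfl⟩
    refine ⟨y₁ + θ • (y₂ - y₁), ⟨θ, hθ, rfl⟩, ?_⟩
    ext j
    by_cases hj : j = i
    · subst hj; simp
    · simp [hj]
  · rintro ⟨y, ⟨θ, hθ, rfl⟩, rfl⟩
    refine ⟨θ, hθ, ?_⟩
    ext j
    by_cases hj : j = i
    · subst hj; simp
    · simp [hj]

/-- A continuous monotone map of ℝ maps [[y₁, y₂]] onto [[f y₁, f y₂]]. [cite: Balaban1987RG1, p.257 (linear size d_j, edges of cubes)] -/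
theorem image_uIcc_of_monotone {f : ℝ → ℝ} (hf : Monotone f) (hc : Continuous f) (y₁ y₂ : ℝ) :
    f '' Set.uIcc y₁ y₂ = Set.uIcc (f y₁) (f y₂) := by
  apply Set.Subset.antisymm
  · rintro _ ⟨y, hy, rfl⟩
    rcases le_total y₁ y₂ with h | h
    · rw [Set.uIcc_of_le h] at hy
      rw [Set.uIcc_of_le (hf h)]
      exact ⟨hf hy.1, hf hy.2⟩
    · rw [Set.uIcc_comm, Set.uIcc_of_le h] at hy
      rw [Set.uIcc_comm, Set.uIcc_of_le (hf h)]
      exact ⟨hf hy.1, hf hy.2⟩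
  · exact intermediate_value_uIcc hc.continuousOn

/-- IMAGE OF AN AXIS-PARALLEL SEGMENT under the sliding map = the segment between the images of its endpoints
(for a monotone continuous slide). [cite: Balaban1987RG1, p.257 (linear size d_j, edges of cubes)] -/
theorem image_Fmove_segment (i : Fin d) {sm s sp t : ℝ} (hmono : Monotone (fmove sm s sp t)) {a b : RPt d}
    (hab : AxisParallel (a, b)) :
    Fmove i sm s sp t '' segment ℝ a b = segment ℝ (Fmove i sm s sp t a) (Fmove i sm s sp t b) := by
  by_cases hi : a i = b i
  · -- orthogonal case: the slide is a translation on the segment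
    have hconst : ∀ q ∈ segment ℝ a b, q i = a i := by
      intro q hq
      rw [segment_eq_image'] at hq
      obtain ⟨θ, -, rfl⟩ := hq
      simp [hi]
    set v : RPt d := Function.update (0 : RPt d) i (fmove sm s sp t (a i) - a i) with hv
    have hF : ∀ q ∈ segment ℝ a b, Fmove i sm s sp t q = v + q := by
      intro q hq
      ext j
      rw [Fmove_apply]
      by_cases hj : j = i
      · subst hj; simp [hv, hconst q hq]
      · simp [hv, hj]
    rw [Set.image_congr hF, segment_translate_image, ← hF a (left_mem_segment ℝ a b),
      ← hF b (right_mem_segment ℝ a b)]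
  · -- parallel case
    have hj : ∀ j, j ≠ i → a j = b j := by
      intro j hji
      by_contra hne
      exact hji (hab j i hne hi)
    have hb : b = Function.update a i (b i) := by
      ext j
      by_cases hji : j = i
      · subst hji; simp
      · simp [hji, hj j hji]
    have ha : a = Function.update a i (a i) := (Function.update_eq_self i a).symm
    have hFa : ∀ y, Fmove i sm s sp t (Function.update a i y) = Function.update a i (fmove sm s sp t y) := by
      intro y
      ext j
      rw [Fmove_apply]
      by_cases hji : j = i
      · subst hji; simp
      · simp [hji]
    conv_lhs => rw [ha, hb, segment_update, Set.image_image]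
    rw [Set.image_congr (fun y _ => hFa y), ← Set.image_image (g := Function.update a i),
      image_uIcc_of_monotone hmono (continuous_fmove sm s sp t), ← segment_update]
    have e1 : Function.update a i (fmove sm s sp t (a i)) = Fmove i sm s sp t a := by
      rw [← hFa (a i), ← ha]
    have e2 : Function.update a i (fmove sm s sp t (b i)) = Fmove i sm s sp t b := by
      rw [← hFa (b i), ← hb]
    rw [e1, e2]

/-- The slid graph: every segment replaced by the segment between the slid endpoints. [cite: Balaban1987RG1, p.257 (linear size d_j, edges of cubes)] -/
def slide (i : Fin d) (sm s sp t : ℝ) (T : List (Seg d)) : List (Seg d) :=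
  T.map fun σ => (Fmove i sm s sp t σ.1, Fmove i sm s sp t σ.2)

/-- The carrier of the slid rectilinear graph is the image of the carrier under the sliding map. [cite: Balaban1987RG1, p.257 (linear size d_j, edges of cubes)] -/
theorem carrier_slide (i : Fin d) {sm s sp t : ℝ} (hmono : Monotone (fmove sm s sp t)) :
    ∀ (T : List (Seg d)), Rectilinear T → carrier (slide i sm s sp t T) = Fmove i sm s sp t '' carrier T
  | [], _ => by simp [slide]
  | σ :: T, hR => by
      have ih := carrier_slide i hmono T fun σ' h => hR σ' (List.mem_cons_of_mem _ h)
      rw [slide, List.map_cons, carrier_cons, ← slide, ih, carrier_cons, Set.image_union,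
        image_Fmove_segment i hmono (hR σ List.mem_cons_self)]

/-- Sliding preserves rectilinearity. [cite: Balaban1987RG1, p.257 (linear size d_j, edges of cubes)] -/
theorem rectilinear_slide (i : Fin d) (sm s sp t : ℝ) {T : List (Seg d)} (hR : Rectilinear T) :
    Rectilinear (slide i sm s sp t T) := by
  intro σ hσ
  obtain ⟨τ, hτ, rfl⟩ := List.mem_map.1 hσ
  intro j k hj hk
  simp only [Fmove_apply] at hj hk
  refine hR τ hτ j k ?_ ?_
  · intro h
    apply hj
    by_cases hji : j = i
    · subst hji; simp [h]
    · simp [hji, h]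
  · intro h
    apply hk
    by_cases hki : k = i
    · subst hki; simp [h]
    · simp [hki, h]

/-- The sliding map preserves every closed unit cube (no integer lies strictly between s⁻ and s⁺). [cite: Balaban1987RG1, p.257 (linear size d_j, edges of cubes)] -/
theorem Fmove_mem_cube (i : Fin d) {sm s sp t : ℝ} (hsm : sm < s) (hsp : s < sp) (ht1 : sm - s ≤ t)
    (ht2 : t ≤ sp - s) (hgap : ∀ z : ℤ, (z : ℝ) ≤ sm ∨ sp ≤ z) {y : Pt d} {p : RPt d} (hp : p ∈ cube y) :
    Fmove i sm s sp t p ∈ cube y := by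
  rw [mem_cube] at hp ⊢
  intro j
  rw [Fmove_apply]
  by_cases hj : j = i
  · subst hj
    simp only [if_true]
    exact fmove_mem_Icc hsm hsp ht1 ht2 hgap (hp j).1 (hp j).2
  · simp only [hj, if_false]
    exact hp j

/-- THE SNAPPING STEP PRESERVES ADMISSIBILITY. [cite: Balaban1987RG1, p.257 (linear size d_j, edges of cubes)] -/
theorem admissible_slide {X : Finset (Pt d)} (i : Fin d) {sm s sp t : ℝ} (hsm : sm < s) (hsp : s < sp)
    (ht1 : sm - s ≤ t) (ht2 : t ≤ sp - s) (hgap : ∀ z : ℤ, (z : ℝ) ≤ sm ∨ sp ≤ z) {T : List (Seg d)}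
    (hT : Admissible X T) (hR : Rectilinear T) : Admissible X (slide i sm s sp t T) := by
  have hmono := monotone_fmove (sp := sp) hsm hsp ht1 ht2
  have hc := carrier_slide i hmono T hR
  refine ⟨?_, ?_, ?_⟩
  · rw [hc]; exact hT.connected.image _ (continuous_Fmove i sm s sp t).continuousOn
  · rw [hc]
    rintro _ ⟨p, hp, rfl⟩
    obtain ⟨y, hy, hpy⟩ := mem_cubes.1 (hT.subset hp)
    exact mem_cubes.2 ⟨y, hy, Fmove_mem_cube i hsm hsp ht1 ht2 hgap hpy⟩
  · intro y hy
    obtain ⟨z, hz, hzy⟩ := hT.meets y hy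
    refine ⟨Fmove i sm s sp t z, ?_, Fmove_mem_cube i hsm hsp ht1 ht2 hgap hzy⟩
    rw [hc]; exact ⟨z, hz, rfl⟩

/-- LENGTH BOOKKEEPING: the ℓ¹ length of a slid axis-parallel segment whose endpoint i-levels are levels. [cite: Balaban1987RG1, p.257 (linear size d_j, edges of cubes)] -/
theorem dist1_Fmove (i : Fin d) {sm s sp t : ℝ} (hsm : sm < s) (hsp : s < sp) (ht1 : sm - s ≤ t)
    (ht2 : t ≤ sp - s) {a b : RPt d} (ha : a i = s ∨ a i ≤ sm ∨ sp ≤ a i) (hb : b i = s ∨ b i ≤ sm ∨ sp ≤ b i) :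
    dist1 (Fmove i sm s sp t a) (Fmove i sm s sp t b) = dist1 a b + t * eps s (a i) (b i) := by
  unfold dist1
  have : ∑ j, |Fmove i sm s sp t a j - Fmove i sm s sp t b j| - ∑ j, |a j - b j| = t * eps s (a i) (b i) := by
    rw [← Finset.sum_sub_distrib, Finset.sum_eq_single i]
    · simp only [Fmove_apply, if_true]
      rw [abs_fmove_sub_fmove hsm hsp ht1 ht2 ha hb]
      ring
    · intro j _ hj
      simp [Fmove_apply, hj]
    · intro h; exact absurd (Finset.mem_univ i) h
  linarith

/-- The ℓ¹ length of the slid graph is AFFINE in the shift: len1 = len1 + t·(sum of slopes). [cite: Balaban1987RG1, p.257 (linear size d_j, edges of cubes)] -/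
theorem len1_slide (i : Fin d) {sm s sp t : ℝ} (hsm : sm < s) (hsp : s < sp) (ht1 : sm - s ≤ t)
    (ht2 : t ≤ sp - s) : ∀ (T : List (Seg d)),
    (∀ σ ∈ T, (σ.1 i = s ∨ σ.1 i ≤ sm ∨ sp ≤ σ.1 i) ∧ (σ.2 i = s ∨ σ.2 i ≤ sm ∨ sp ≤ σ.2 i)) →
    len1 (slide i sm s sp t T) = len1 T + t * (T.map fun σ => eps s (σ.1 i) (σ.2 i)).sum
  | [], _ => by simp [slide]
  | σ :: T, h => by
      have ih := len1_slide i hsm hsp ht1 ht2 T fun σ' h' => h σ' (List.mem_cons_of_mem _ h')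
      rw [slide, List.map_cons, len1_cons, ← slide, ih, len1_cons, List.map_cons, List.sum_cons,
        dist1_Fmove i hsm hsp ht1 ht2 (h σ List.mem_cons_self).1 (h σ List.mem_cons_self).2]
      ring

/-! ## §5. Levels, the bad (non-integer) levels, and the snapping induction -/

/-- The i-coordinate LEVELS of the endpoints of a graph. [cite: Balaban1987RG1, p.257 (linear size d_j, edges of cubes)] -/
def levels (T : List (Seg d)) (i : Fin d) : Finset ℝ := ((T.map fun σ => σ.1 i) ++ T.map fun σ => σ.2 i).toFinset

/-- Endpoint coordinates are levels. [cite: Balaban1987RG1, p.257 (linear size d_j, edges of cubes)] -/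
theorem mem_levels {T : List (Seg d)} {i : Fin d} {σ : Seg d} (hσ : σ ∈ T) :
    σ.1 i ∈ levels T i ∧ σ.2 i ∈ levels T i := by
  classical
  simp only [levels, List.mem_toFinset, List.mem_append, List.mem_map]
  exact ⟨Or.inl ⟨σ, hσ, rfl⟩, Or.inr ⟨σ, hσ, rfl⟩⟩

/-- A level is an endpoint coordinate. [cite: Balaban1987RG1, p.257 (linear size d_j, edges of cubes)] -/
theorem exists_of_mem_levels {T : List (Seg d)} {i : Fin d} {lam : ℝ} (h : lam ∈ levels T i) :
    ∃ σ ∈ T, σ.1 i = lam ∨ σ.2 i = lam := by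
  classical
  simp only [levels, List.mem_toFinset, List.mem_append, List.mem_map] at h
  rcases h with ⟨σ, hσ, h⟩ | ⟨σ, hσ, h⟩
  · exact ⟨σ, hσ, Or.inl h⟩
  · exact ⟨σ, hσ, Or.inr h⟩

/-- A real number is an integer. [cite: Balaban1987RG1, p.257 (linear size d_j, edges of cubes)] -/
def IsInt (x : ℝ) : Prop := ∃ z : ℤ, (z : ℝ) = x

open Classical in
/-- The BAD LEVELS: pairs (i, λ) with λ a non-integer i-level. [cite: Balaban1987RG1, p.257 (linear size d_j, edges of cubes)] -/
def bad (T : List (Seg d)) : Finset (Fin d × ℝ) :=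
  Finset.univ.biUnion fun i => ((levels T i).filter fun lam => ¬ IsInt lam).image (Prod.mk i)

/-- Membership in the bad set. [cite: Balaban1987RG1, p.257 (linear size d_j, edges of cubes)] -/
theorem mem_bad {T : List (Seg d)} {i : Fin d} {lam : ℝ} : (i, lam) ∈ bad T ↔ lam ∈ levels T i ∧ ¬ IsInt lam := by
  classical
  unfold bad
  rw [Finset.mem_biUnion]
  constructor
  · rintro ⟨j, -, h⟩
    rw [Finset.mem_image] at h
    obtain ⟨μ, hμ, hjμ⟩ := h
    rw [Finset.mem_filter] at hμ
    obtain ⟨rfl, rfl⟩ := Prod.mk.inj hjμ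
    exact hμ
  · rintro ⟨h1, h2⟩
    refine ⟨i, Finset.mem_univ _, ?_⟩
    rw [Finset.mem_image]
    exact ⟨lam, Finset.mem_filter.2 ⟨h1, h2⟩, rfl⟩

/-- No bad levels ⇒ all endpoints are lattice points. [cite: Balaban1987RG1, p.257 (linear size d_j, edges of cubes)] -/
theorem latticeEnds_of_bad_eq_empty {T : List (Seg d)} (h : bad T = ∅) : LatticeEnds T := by
  have hint : ∀ σ ∈ T, ∀ i, IsInt (σ.1 i) ∧ IsInt (σ.2 i) := by
    intro σ hσ i
    obtain ⟨h1, h2⟩ := mem_levels (i := i) hσ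
    constructor
    · by_contra hc
      have : (i, σ.1 i) ∈ bad T := mem_bad.2 ⟨h1, hc⟩
      rw [h] at this; simp at this
    · by_contra hc
      have : (i, σ.2 i) ∈ bad T := mem_bad.2 ⟨h2, hc⟩
      rw [h] at this; simp at this
  intro σ hσ
  constructor
  · choose z hz using fun i => (hint σ hσ i).1
    exact ⟨z, funext fun i => by simp [corner, hz i]⟩
  · choose z hz using fun i => (hint σ hσ i).2
    exact ⟨z, funext fun i => by simp [corner, hz i]⟩

/-- THE SNAPPING STEP: a rectilinear admissible graph with a bad level (i, s) can be slid to a rectilinear admissible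
graph that is not longer (ℓ¹) and has fewer bad levels. [cite: Balaban1987RG1, p.257 (linear size d_j, edges of cubes)] -/
theorem snapping_step {X : Finset (Pt d)} {T : List (Seg d)} (hT : Admissible X T) (hR : Rectilinear T)
    {i : Fin d} {s : ℝ} (hs : (i, s) ∈ bad T) :
    ∃ T', Admissible X T' ∧ Rectilinear T' ∧ len1 T' ≤ len1 T ∧ (bad T').card < (bad T).card := by
  classical
  obtain ⟨hsl, hsZ⟩ := mem_bad.1 hs
  -- the comparison levels
  set Λ : Finset ℝ := levels T i ∪ {(⌊s⌋ : ℝ), (⌊s⌋ : ℝ) + 1} with hΛ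
  have hflo : (⌊s⌋ : ℝ) < s := by
    rcases (Int.floor_le s).lt_or_eq with h | h
    · exact h
    · exact absurd ⟨⌊s⌋, h⟩ hsZ
  have hfhi : s < (⌊s⌋ : ℝ) + 1 := Int.lt_floor_add_one s
  have hfloΛ : (⌊s⌋ : ℝ) ∈ Λ := by rw [hΛ]; simp
  have hfhiΛ : (⌊s⌋ : ℝ) + 1 ∈ Λ := by rw [hΛ]; simp
  have hmemlo : (⌊s⌋ : ℝ) ∈ Λ.filter fun x => x < s := Finset.mem_filter.2 ⟨hfloΛ, hflo⟩
  have hmemhi : (⌊s⌋ : ℝ) + 1 ∈ Λ.filter fun x => s < x := Finset.mem_filter.2 ⟨hfhiΛ, hfhi⟩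
  have hlo_ne : (Λ.filter fun x => x < s).Nonempty := ⟨_, hmemlo⟩
  have hhi_ne : (Λ.filter fun x => s < x).Nonempty := ⟨_, hmemhi⟩
  set sm := (Λ.filter fun x => x < s).max' hlo_ne with hsm_def
  set sp := (Λ.filter fun x => s < x).min' hhi_ne with hsp_def
  have hsm : sm < s := (Finset.mem_filter.1 (Finset.max'_mem _ hlo_ne)).2
  have hsp : s < sp := (Finset.mem_filter.1 (Finset.min'_mem _ hhi_ne)).2
  have hlev : ∀ lam ∈ Λ, lam = s ∨ lam ≤ sm ∨ sp ≤ lam := by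
    intro lam hlam
    rcases lt_trichotomy lam s with h | h | h
    · have hm : lam ∈ Λ.filter fun x => x < s := Finset.mem_filter.2 ⟨hlam, h⟩
      exact Or.inr (Or.inl (Finset.le_max' _ lam hm))
    · exact Or.inl h
    · have hm : lam ∈ Λ.filter fun x => s < x := Finset.mem_filter.2 ⟨hlam, h⟩
      exact Or.inr (Or.inr (Finset.min'_le _ lam hm))
  have hflo_le : (⌊s⌋ : ℝ) ≤ sm := Finset.le_max' _ _ hmemlo
  have hfhi_ge : sp ≤ (⌊s⌋ : ℝ) + 1 := Finset.min'_le _ _ hmemhi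
  have hgap : ∀ z : ℤ, (z : ℝ) ≤ sm ∨ sp ≤ z := by
    intro z
    rcases le_or_gt z ⌊s⌋ with h | h
    · left; exact le_trans (by exact_mod_cast h) hflo_le
    · right; refine le_trans hfhi_ge ?_; exact_mod_cast h
  have hsmΛ : sm ∈ Λ := (Finset.mem_filter.1 (Finset.max'_mem _ hlo_ne)).1
  have hspΛ : sp ∈ Λ := (Finset.mem_filter.1 (Finset.min'_mem _ hhi_ne)).1
  have hends : ∀ σ ∈ T, (σ.1 i = s ∨ σ.1 i ≤ sm ∨ sp ≤ σ.1 i) ∧ (σ.2 i = s ∨ σ.2 i ≤ sm ∨ sp ≤ σ.2 i) := by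
    intro σ hσ
    obtain ⟨h1, h2⟩ := mem_levels (i := i) hσ
    exact ⟨hlev _ (Finset.mem_union_left _ h1), hlev _ (Finset.mem_union_left _ h2)⟩
  -- choose the direction of the slide by the sign of the total slope
  set E : ℝ := (T.map fun σ => eps s (σ.1 i) (σ.2 i)).sum with hE
  set t : ℝ := if 0 ≤ E then sm - s else sp - s with ht
  have ht1 : sm - s ≤ t := by rw [ht]; split_ifs <;> linarith
  have ht2 : t ≤ sp - s := by rw [ht]; split_ifs <;> linarith
  have htE : t * E ≤ 0 := by
    rw [ht]; split_ifs with h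
    · exact mul_nonpos_of_nonpos_of_nonneg (by linarith) h
    · exact mul_nonpos_of_nonneg_of_nonpos (by linarith) (le_of_lt (not_le.1 h))
  have hst : s + t = sm ∨ s + t = sp := by rw [ht]; split_ifs <;> simp
  refine ⟨slide i sm s sp t T, admissible_slide i hsm hsp ht1 ht2 hgap hT hR, rectilinear_slide i sm s sp t hR,
    ?_, ?_⟩
  · rw [len1_slide i hsm hsp ht1 ht2 T hends, ← hE]
    linarith
  · -- the bad set shrinks: bad T' ⊆ bad T \ {(i, s)}
    apply Finset.card_lt_card
    refine ⟨?_, fun hsub => ?_⟩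
    · intro q hq
      obtain ⟨j, lam⟩ := q
      obtain ⟨hl, hnz⟩ := mem_bad.1 hq
      obtain ⟨σ', hσ', hσ'l⟩ := exists_of_mem_levels hl
      obtain ⟨σ, hσ, rfl⟩ := List.mem_map.1 hσ'
      simp only [Fmove_apply] at hσ'l
      by_cases hji : j = i
      · subst hji
        simp only [if_true] at hσ'l
        -- lam = fmove (σ.1 i) or fmove (σ.2 i): a level of T or s + t ∈ {sm, sp}
        have key : ∀ μ, (μ = s ∨ μ ≤ sm ∨ sp ≤ μ) → μ ∈ levels T j → fmove sm s sp t μ = lam →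
            (j, lam) ∈ bad T := by
          intro μ hμ hμl hμeq
          rcases hμ with hμs | hμ
          · rw [hμs, fmove_self hsm hsp] at hμeq
            rw [← hμeq] at hnz ⊢
            rcases hst with h | h <;> rw [h] at hnz ⊢
            · have : sm ∈ levels T j := by
                rcases Finset.mem_union.1 hsmΛ with h' | h'
                · exact h'
                · simp only [Finset.mem_insert, Finset.mem_singleton] at h'
                  rcases h' with h' | h'
                  · exact absurd ⟨⌊s⌋, h'.symm⟩ hnz
                  · exact absurd ⟨⌊s⌋ + 1, by push_cast; exact h'.symm⟩ hnz
              exact mem_bad.2 ⟨this, hnz⟩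
            · have : sp ∈ levels T j := by
                rcases Finset.mem_union.1 hspΛ with h' | h'
                · exact h'
                · simp only [Finset.mem_insert, Finset.mem_singleton] at h'
                  rcases h' with h' | h'
                  · exact absurd ⟨⌊s⌋, h'.symm⟩ hnz
                  · exact absurd ⟨⌊s⌋ + 1, by push_cast; exact h'.symm⟩ hnz
              exact mem_bad.2 ⟨this, hnz⟩
          · rw [fmove_of_level hsm hsp hμ] at hμeq
            rw [← hμeq] at hnz ⊢
            exact mem_bad.2 ⟨hμl, hnz⟩
        rcases hσ'l with h | h
        · exact key _ (hends σ hσ).1 (mem_levels hσ).1 h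
        · exact key _ (hends σ hσ).2 (mem_levels hσ).2 h
      · simp only [hji, if_false] at hσ'l
        refine mem_bad.2 ⟨?_, hnz⟩
        rcases hσ'l with h | h
        · exact h ▸ (mem_levels hσ).1
        · exact h ▸ (mem_levels hσ).2
    · -- (i, s) is bad for T but not for T'
      have hs' : (i, s) ∈ bad (slide i sm s sp t T) := hsub hs
      obtain ⟨hl, -⟩ := mem_bad.1 hs'
      obtain ⟨σ', hσ', hσ'l⟩ := exists_of_mem_levels hl
      obtain ⟨σ, hσ, rfl⟩ := List.mem_map.1 hσ'
      simp only [Fmove_apply, if_true] at hσ'l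
      have key : ∀ μ, (μ = s ∨ μ ≤ sm ∨ sp ≤ μ) → fmove sm s sp t μ ≠ s := by
        intro μ hμ
        rcases hμ with hμs | hμ
        · rw [hμs, fmove_self hsm hsp]
          rcases hst with h | h <;> rw [h] <;> linarith
        · rw [fmove_of_level hsm hsp hμ]
          rintro rfl
          rcases hμ with hμ | hμ <;> linarith
      rcases hσ'l with h | h
      · exact key _ (hends σ hσ).1 h
      · exact key _ (hends σ hσ).2 h

/-- PHASE II — GRID SNAPPING (a Hanan-type lemma for cube terminals): every rectilinear admissible graph is
dominated in ℓ¹ length by a rectilinear admissible graph with LATTICE endpoints. [cite: Balaban1987RG1, p.257 (linear size d_j, edges of cubes)] -/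
theorem exists_lattice_of_rectilinear {X : Finset (Pt d)} : ∀ (n : ℕ) (T : List (Seg d)),
    Admissible X T → Rectilinear T → (bad T).card ≤ n →
    ∃ T', Admissible X T' ∧ Rectilinear T' ∧ LatticeEnds T' ∧ len1 T' ≤ len1 T := by
  intro n
  induction n with
  | zero =>
      intro T hT hR hcard
      have : bad T = ∅ := Finset.card_eq_zero.1 (Nat.le_zero.1 hcard)
      exact ⟨T, hT, hR, latticeEnds_of_bad_eq_empty this, le_rfl⟩
  | succ n ih =>
      intro T hT hR hcard
      by_cases h0 : bad T = ∅
      · exact ⟨T, hT, hR, latticeEnds_of_bad_eq_empty h0, le_rfl⟩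
      · obtain ⟨⟨i, s⟩, hs⟩ := Finset.nonempty_iff_ne_empty.2 h0
        obtain ⟨T₁, hT₁, hR₁, hlen₁, hcard₁⟩ := snapping_step hT hR hs
        obtain ⟨T', hT', hR', hL', hlen'⟩ := ih T₁ hT₁ hR₁ (by omega)
        exact ⟨T', hT', hR', hL', hlen'.trans hlen₁⟩

/-- Hence: FOR RECTILINEAR ADMISSIBLE GRAPHS, `edgeLen X ≤ len1 T` — among the rectilinear graphs the ℓ¹-shortest
are the edge graphs. [cite: Balaban1987RG1, p.257 (linear size d_j, edges of cubes)] -/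
theorem edgeLen_le_len1_of_rectilinear {X : Finset (Pt d)} {T : List (Seg d)} (hT : Admissible X T)
    (hR : Rectilinear T) : (edgeLen X : ℝ) ≤ len1 T := by
  obtain ⟨T', hT', hR', hL', hlen'⟩ := exists_lattice_of_rectilinear _ T hT hR le_rfl
  exact (edgeLen_le_len1_of_rectilinear_lattice hT' hR' hL').trans hlen'


/-! ## §6. Phase I — every admissible graph is dominated in ℓ¹ length by a RECTILINEAR admissible graph
(subdivision of each segment at finitely many parameters, each piece replaced by the axis-parallel STAIRCASE inside
one cube of X; re-attachment through a finite set of ANCHOR points) -/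

/-! ### §6.1 The parametrisation: ℓ¹ length along a segment, betweenness in a cube -/

/-- ℓ¹ distance along the parametrisation: |γ_σ(s) − γ_σ(t)|₁ = |s − t|·|σ₁ − σ₂|₁. [cite: Balaban1987RG1, p.257 (linear size d_j, edges of cubes)] -/
theorem dist1_gam_gam (σ : Seg d) (s t : ℝ) : dist1 (gam σ s) (gam σ t) = |s - t| * dist1 σ.1 σ.2 := by
  unfold dist1
  rw [Finset.mul_sum]
  refine Finset.sum_congr rfl fun i _ => ?_
  rw [gam_apply, gam_apply, ← abs_mul]
  rw [show σ.1 i + s * (σ.2 i - σ.1 i) - (σ.1 i + t * (σ.2 i - σ.1 i)) = -((s - t) * (σ.1 i - σ.2 i)) by ring,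
    abs_neg]

/-- Points of the parametrisation with parameter in [0, 1] lie on the segment. [cite: Balaban1987RG1, p.257 (linear size d_j, edges of cubes)] -/
theorem gam_mem_segment_of_mem_Icc (σ : Seg d) {t : ℝ} (ht : t ∈ Set.Icc (0 : ℝ) 1) :
    gam σ t ∈ segment ℝ σ.1 σ.2 := by
  rw [segment_eq_image_gam]
  exact ⟨t, ht, rfl⟩

/-- BETWEENNESS: if γ_σ(u₁) and γ_σ(u₂) lie in a cube then so does γ_σ(u) for u₁ ≤ u ≤ u₂ (cubes are boxes and
the coordinates of γ_σ are affine). [cite: Balaban1987RG1, p.257 (linear size d_j, edges of cubes)] -/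
theorem gam_mem_cube_of_le_of_le {σ : Seg d} {x : Pt d} {u₁ u₂ u : ℝ} (h₁ : gam σ u₁ ∈ cube x)
    (h₂ : gam σ u₂ ∈ cube x) (hu₁ : u₁ ≤ u) (hu₂ : u ≤ u₂) : gam σ u ∈ cube x := by
  rw [mem_cube] at h₁ h₂ ⊢
  intro i
  obtain ⟨a1, b1⟩ := h₁ i
  obtain ⟨a2, b2⟩ := h₂ i
  rw [gam_apply] at a1 b1 a2 b2 ⊢
  rcases le_total 0 (σ.2 i - σ.1 i) with hδ | hδ
  · have e1 : u₁ * (σ.2 i - σ.1 i) ≤ u * (σ.2 i - σ.1 i) := mul_le_mul_of_nonneg_right hu₁ hδ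
    have e2 : u * (σ.2 i - σ.1 i) ≤ u₂ * (σ.2 i - σ.1 i) := mul_le_mul_of_nonneg_right hu₂ hδ
    constructor <;> linarith
  · have e1 : u * (σ.2 i - σ.1 i) ≤ u₁ * (σ.2 i - σ.1 i) := mul_le_mul_of_nonpos_right hu₁ hδ
    have e2 : u₂ * (σ.2 i - σ.1 i) ≤ u * (σ.2 i - σ.1 i) := mul_le_mul_of_nonpos_right hu₂ hδ
    constructor <;> linarith

/-! ### §6.2 The axis-parallel staircase between two points of a cube -/

/-- The k-th corner of the STAIRCASE from p to q: the first k coordinates taken from q, the others from p. [cite: Balaban1987RG1, p.257 (linear size d_j, edges of cubes)] -/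
def stairPt (p q : RPt d) (k : ℕ) : RPt d := fun j => if (j : ℕ) < k then q j else p j

/-- The 0-th corner is p. [cite: Balaban1987RG1, p.257 (linear size d_j, edges of cubes)] -/
@[simp] theorem stairPt_zero (p q : RPt d) : stairPt p q 0 = p := by
  funext j
  simp [stairPt]

/-- From the d-th corner on, the corner is q. [cite: Balaban1987RG1, p.257 (linear size d_j, edges of cubes)] -/
theorem stairPt_of_le {p q : RPt d} {k : ℕ} (hk : d ≤ k) : stairPt p q k = q := by
  funext j
  simp [stairPt, lt_of_lt_of_le j.isLt hk]

/-- Corners of the staircase of two points of a cube lie in that cube (cubes are boxes). [cite: Balaban1987RG1, p.257 (linear size d_j, edges of cubes)] -/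
theorem stairPt_mem_cube {x : Pt d} {p q : RPt d} (hp : p ∈ cube x) (hq : q ∈ cube x) (k : ℕ) :
    stairPt p q k ∈ cube x := by
  rw [mem_cube] at hp hq ⊢
  intro j
  by_cases h : (j : ℕ) < k
  · simp only [stairPt, h, if_true]
    exact hq j
  · simp only [stairPt, h, if_false]
    exact hp j

/-- Consecutive corners agree off the k-th coordinate. [cite: Balaban1987RG1, p.257 (linear size d_j, edges of cubes)] -/
theorem stairPt_succ_apply_of_ne {p q : RPt d} {k : ℕ} {j : Fin d} (hj : (j : ℕ) ≠ k) :
    stairPt p q (k + 1) j = stairPt p q k j := by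
  by_cases h : (j : ℕ) < k
  · simp [stairPt, h, show (j : ℕ) < k + 1 by omega]
  · simp [stairPt, h, show ¬ (j : ℕ) < k + 1 by omega]

/-- Each step of the staircase is axis-parallel. [cite: Balaban1987RG1, p.257 (linear size d_j, edges of cubes)] -/
theorem axisParallel_stairPt (p q : RPt d) (k : ℕ) : AxisParallel (stairPt p q k, stairPt p q (k + 1)) := by
  intro j j' hj hj'
  have h1 : (j : ℕ) = k := by
    by_contra hne
    exact hj (stairPt_succ_apply_of_ne hne).symm
  have h2 : (j' : ℕ) = k := by
    by_contra hne
    exact hj' (stairPt_succ_apply_of_ne hne).symm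
  exact Fin.ext (h1.trans h2.symm)

/-- The ℓ¹ length of the k-th step is |p_k − q_k| (0 if k ≥ d). [cite: Balaban1987RG1, p.257 (linear size d_j, edges of cubes)] -/
theorem dist1_stairPt_succ (p q : RPt d) (k : ℕ) :
    dist1 (stairPt p q k) (stairPt p q (k + 1)) = ∑ j : Fin d, if (j : ℕ) = k then |p j - q j| else 0 := by
  unfold dist1
  refine Finset.sum_congr rfl fun j _ => ?_
  by_cases h : (j : ℕ) = k
  · rw [if_pos h]
    have h1 : ¬ (j : ℕ) < k := by omega
    have h2 : (j : ℕ) < k + 1 := by omega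
    simp only [stairPt, h1, h2, if_false, if_true]
  · rw [if_neg h, stairPt_succ_apply_of_ne h, sub_self, abs_zero]

/-- The first m steps of the staircase from p to q. [cite: Balaban1987RG1, p.257 (linear size d_j, edges of cubes)] -/
def stairSteps (p q : RPt d) : ℕ → List (Seg d)
  | 0 => []
  | m + 1 => stairSteps p q m ++ [(stairPt p q m, stairPt p q (m + 1))]

/-- THE STAIRCASE from p to q: the degenerate segment [p, p] (so that the carrier is never empty) followed by the d
axis-parallel steps p = w₀, w₁, …, w_d = q. [cite: Balaban1987RG1, p.257 (linear size d_j, edges of cubes)] -/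
def staircase (p q : RPt d) : List (Seg d) := (p, p) :: stairSteps p q d

/-- ℓ¹ length of the first m steps. [cite: Balaban1987RG1, p.257 (linear size d_j, edges of cubes)] -/
theorem len1_stairSteps (p q : RPt d) : ∀ m : ℕ,
    len1 (stairSteps p q m) = ∑ j : Fin d, if (j : ℕ) < m then |p j - q j| else 0
  | 0 => by simp [stairSteps]
  | m + 1 => by
      rw [stairSteps, len1_append, len1_stairSteps p q m, len1_cons, len1_nil, add_zero, dist1_stairPt_succ,
        ← Finset.sum_add_distrib]
      refine Finset.sum_congr rfl fun j _ => ?_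
      by_cases h1 : (j : ℕ) < m
      · rw [if_pos h1, if_neg (by omega), if_pos (by omega), add_zero]
      · by_cases h2 : (j : ℕ) = m
        · rw [if_neg h1, if_pos h2, if_pos (by omega), zero_add]
        · rw [if_neg h1, if_neg h2, if_neg (by omega), add_zero]

/-- THE STAIRCASE HAS ℓ¹ LENGTH |p − q|₁. [cite: Balaban1987RG1, p.257 (linear size d_j, edges of cubes)] -/
theorem len1_staircase (p q : RPt d) : len1 (staircase p q) = dist1 p q := by
  rw [staircase, len1_cons]
  show dist1 p p + len1 (stairSteps p q d) = dist1 p q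
  rw [dist1_self, zero_add, len1_stairSteps]
  exact Finset.sum_congr rfl fun j _ => if_pos j.isLt

/-- Members of the step list are steps. [cite: Balaban1987RG1, p.257 (linear size d_j, edges of cubes)] -/
theorem mem_stairSteps {p q : RPt d} : ∀ {m : ℕ} {s : Seg d}, s ∈ stairSteps p q m →
    ∃ k, s = (stairPt p q k, stairPt p q (k + 1))
  | 0, s, h => by simp [stairSteps] at h
  | m + 1, s, h => by
      rw [stairSteps, List.mem_append, List.mem_singleton] at h
      rcases h with h | rfl
      · exact mem_stairSteps h
      · exact ⟨m, rfl⟩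

/-- The staircase is rectilinear. [cite: Balaban1987RG1, p.257 (linear size d_j, edges of cubes)] -/
theorem rectilinear_staircase (p q : RPt d) : Rectilinear (staircase p q) := by
  intro s hs
  rcases List.mem_cons.1 hs with rfl | hs
  · intro j k hj _
    exact absurd rfl hj
  · obtain ⟨k, rfl⟩ := mem_stairSteps hs
    exact axisParallel_stairPt p q k

/-- The m-th corner lies on the first m steps (together with [p, p]). [cite: Balaban1987RG1, p.257 (linear size d_j, edges of cubes)] -/
theorem stairPt_mem_carrier (p q : RPt d) : ∀ m : ℕ, stairPt p q m ∈ carrier ((p, p) :: stairSteps p q m)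
  | 0 => by
      rw [stairPt_zero, carrier_cons]
      exact Or.inl (left_mem_segment ℝ p p)
  | m + 1 => by
      rw [stairSteps, ← List.cons_append, carrier_append,
        carrier_cons (stairPt p q m, stairPt p q (m + 1)) [], carrier_nil, Set.union_empty]
      exact Or.inr (right_mem_segment ℝ _ _)

/-- p lies on the staircase. [cite: Balaban1987RG1, p.257 (linear size d_j, edges of cubes)] -/
theorem left_mem_carrier_staircase (p q : RPt d) : p ∈ carrier (staircase p q) := by
  rw [staircase, carrier_cons]
  exact Or.inl (left_mem_segment ℝ p p)

/-- q lies on the staircase. [cite: Balaban1987RG1, p.257 (linear size d_j, edges of cubes)] -/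
theorem right_mem_carrier_staircase (p q : RPt d) : q ∈ carrier (staircase p q) := by
  have h := stairPt_mem_carrier p q d
  rwa [stairPt_of_le le_rfl] at h

/-- The staircase is connected. [cite: Balaban1987RG1, p.257 (linear size d_j, edges of cubes)] -/
theorem isConnected_carrier_stairSteps (p q : RPt d) :
    ∀ m : ℕ, IsConnected (carrier ((p, p) :: stairSteps p q m))
  | 0 => by
      rw [stairSteps, carrier_cons, carrier_nil, Set.union_empty]
      show IsConnected (segment ℝ p p)
      rw [segment_same]
      exact isConnected_singleton
  | m + 1 => by
      rw [stairSteps, ← List.cons_append, carrier_append,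
        carrier_cons (stairPt p q m, stairPt p q (m + 1)) [], carrier_nil, Set.union_empty]
      refine IsConnected.union ⟨stairPt p q m, stairPt_mem_carrier p q m, left_mem_segment ℝ _ _⟩
        (isConnected_carrier_stairSteps p q m) ?_
      exact (convex_segment _ _).isConnected ⟨_, left_mem_segment ℝ _ _⟩

/-- The staircase is connected. [cite: Balaban1987RG1, p.257 (linear size d_j, edges of cubes)] -/
theorem isConnected_carrier_staircase (p q : RPt d) : IsConnected (carrier (staircase p q)) :=
  isConnected_carrier_stairSteps p q d

/-- The staircase of two points of a cube lies in that cube. [cite: Balaban1987RG1, p.257 (linear size d_j, edges of cubes)] -/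
theorem carrier_stairSteps_subset {x : Pt d} {p q : RPt d} (hp : p ∈ cube x) (hq : q ∈ cube x) :
    ∀ m : ℕ, carrier ((p, p) :: stairSteps p q m) ⊆ cube x
  | 0 => by
      rw [stairSteps, carrier_cons, carrier_nil, Set.union_empty]
      show segment ℝ p p ⊆ cube x
      rw [segment_same]
      exact Set.singleton_subset_iff.2 hp
  | m + 1 => by
      rw [stairSteps, ← List.cons_append, carrier_append,
        carrier_cons (stairPt p q m, stairPt p q (m + 1)) [], carrier_nil, Set.union_empty]
      exact Set.union_subset (carrier_stairSteps_subset hp hq m)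
        ((convex_cube x).segment_subset (stairPt_mem_cube hp hq _) (stairPt_mem_cube hp hq _))

/-- The staircase of two points of a cube lies in that cube. [cite: Balaban1987RG1, p.257 (linear size d_j, edges of cubes)] -/
theorem carrier_staircase_subset {x : Pt d} {p q : RPt d} (hp : p ∈ cube x) (hq : q ∈ cube x) :
    carrier (staircase p q) ⊆ cube x :=
  carrier_stairSteps_subset hp hq d

/-! ### §6.3 Rectification of one segment along a sorted list of parameters -/

/-- The rectification of σ along the parameters t₀, t₁, …, t_m: the concatenation of the staircases from γ_σ(t_k) to
γ_σ(t_{k+1}) (and the point γ_σ(t_m)). [cite: Balaban1987RG1, p.257 (linear size d_j, edges of cubes)] -/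
def rectAlong (σ : Seg d) : List ℝ → List (Seg d)
  | [] => []
  | [t] => [(gam σ t, gam σ t)]
  | t :: t' :: L => staircase (gam σ t) (gam σ t') ++ rectAlong σ (t' :: L)

/-- Rectification along two or more parameters (unfolding). [cite: Balaban1987RG1, p.257 (linear size d_j, edges of cubes)] -/
theorem rectAlong_cons_cons (σ : Seg d) (t t' : ℝ) (L : List ℝ) :
    rectAlong σ (t :: t' :: L) = staircase (gam σ t) (gam σ t') ++ rectAlong σ (t' :: L) := rfl

/-- The rectification is rectilinear. [cite: Balaban1987RG1, p.257 (linear size d_j, edges of cubes)] -/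
theorem rectilinear_rectAlong (σ : Seg d) : ∀ L : List ℝ, Rectilinear (rectAlong σ L)
  | [] => by intro s hs; simp [rectAlong] at hs
  | [t] => by
      intro s hs
      simp only [rectAlong, List.mem_singleton] at hs
      subst hs
      intro j k hj _
      exact absurd rfl hj
  | t :: t' :: L => by
      intro s hs
      rw [rectAlong_cons_cons, List.mem_append] at hs
      rcases hs with hs | hs
      · exact rectilinear_staircase _ _ s hs
      · exact rectilinear_rectAlong σ (t' :: L) s hs

/-- The points γ_σ(t_k) lie on the rectification. [cite: Balaban1987RG1, p.257 (linear size d_j, edges of cubes)] -/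
theorem gam_mem_carrier_rectAlong (σ : Seg d) : ∀ {L : List ℝ} {u : ℝ}, u ∈ L → gam σ u ∈ carrier (rectAlong σ L)
  | [], u, h => by simp at h
  | [t], u, h => by
      rw [List.mem_singleton] at h
      subst h
      simp only [rectAlong, carrier_cons, carrier_nil, Set.union_empty]
      exact left_mem_segment ℝ _ _
  | t :: t' :: L, u, h => by
      rw [rectAlong_cons_cons, carrier_append]
      rcases List.mem_cons.1 h with rfl | h
      · exact Or.inl (left_mem_carrier_staircase _ _)
      · exact Or.inr (gam_mem_carrier_rectAlong σ h)

/-- The rectification along a non-empty parameter list is connected. [cite: Balaban1987RG1, p.257 (linear size d_j, edges of cubes)] -/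
theorem isConnected_carrier_rectAlong (σ : Seg d) : ∀ {L : List ℝ}, L ≠ [] → IsConnected (carrier (rectAlong σ L))
  | [], h => (h rfl).elim
  | [t], _ => by
      simp only [rectAlong, carrier_cons, carrier_nil, Set.union_empty]
      rw [segment_same]
      exact isConnected_singleton
  | t :: t' :: L, _ => by
      rw [rectAlong_cons_cons, carrier_append]
      exact IsConnected.union
        ⟨gam σ t', right_mem_carrier_staircase _ _, gam_mem_carrier_rectAlong σ List.mem_cons_self⟩
        (isConnected_carrier_staircase _ _) (isConnected_carrier_rectAlong σ (List.cons_ne_nil _ _))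

/-- ℓ¹ LENGTH OF THE RECTIFICATION along increasing parameters ≤ 1: at most (1 − t₀)·|σ₁ − σ₂|₁ (the staircase
lengths telescope). [cite: Balaban1987RG1, p.257 (linear size d_j, edges of cubes)] -/
theorem len1_rectAlong_le (σ : Seg d) : ∀ {L : List ℝ} (hL : L ≠ []), L.Pairwise (· ≤ ·) → (∀ u ∈ L, u ≤ 1) →
    len1 (rectAlong σ L) ≤ (1 - L.head hL) * dist1 σ.1 σ.2
  | [], h, _, _ => (h rfl).elim
  | [t], _, _, h1 => by
      simp only [rectAlong, len1_cons, len1_nil, List.head_cons]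
      rw [dist1_self]
      have := h1 t (List.mem_singleton_self t)
      nlinarith [dist1_nonneg σ.1 σ.2]
  | t :: t' :: L, _, hP, h1 => by
      rw [rectAlong_cons_cons, len1_append, len1_staircase, dist1_gam_gam]
      have htt' : t ≤ t' := List.rel_of_pairwise_cons hP List.mem_cons_self
      have ih := len1_rectAlong_le σ (List.cons_ne_nil t' L) (List.Pairwise.of_cons hP)
        (fun u hu => h1 u (List.mem_cons_of_mem _ hu))
      simp only [List.head_cons] at ih ⊢
      rw [abs_of_nonpos (by linarith)]
      nlinarith [dist1_nonneg σ.1 σ.2]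

/-! ### §6.4 The cut parameters of a segment: anchors and cube-transition parameters -/

/-- A point of the segment has a parameter in [0, 1]. [cite: Balaban1987RG1, p.257 (linear size d_j, edges of cubes)] -/
theorem exists_gam_eq_of_mem_segment {σ : Seg d} {c : RPt d} (h : c ∈ segment ℝ σ.1 σ.2) :
    ∃ t ∈ Set.Icc (0 : ℝ) 1, gam σ t = c := by
  rw [segment_eq_image_gam] at h
  exact h

open Classical in
/-- A PARAMETER of the point c on σ (0 if c is not on σ). [cite: Balaban1987RG1, p.257 (linear size d_j, edges of cubes)] -/
def paramOf (σ : Seg d) (c : RPt d) : ℝ :=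
  if h : c ∈ segment ℝ σ.1 σ.2 then Classical.choose (exists_gam_eq_of_mem_segment h) else 0

/-- The parameter of a point of σ recovers the point. [cite: Balaban1987RG1, p.257 (linear size d_j, edges of cubes)] -/
theorem paramOf_spec {σ : Seg d} {c : RPt d} (h : c ∈ segment ℝ σ.1 σ.2) :
    paramOf σ c ∈ Set.Icc (0 : ℝ) 1 ∧ gam σ (paramOf σ c) = c := by
  rw [paramOf, dif_pos h]
  exact Classical.choose_spec (exists_gam_eq_of_mem_segment h)

/-- Parameters lie in [0, 1]. [cite: Balaban1987RG1, p.257 (linear size d_j, edges of cubes)] -/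
theorem paramOf_mem_Icc (σ : Seg d) (c : RPt d) : paramOf σ c ∈ Set.Icc (0 : ℝ) 1 := by
  by_cases h : c ∈ segment ℝ σ.1 σ.2
  · exact (paramOf_spec h).1
  · rw [paramOf, dif_neg h]
    exact ⟨le_rfl, zero_le_one⟩

/-- The ENTRY parameter of σ into the cube x (infimum of the parameters in the cube; 0 if σ misses the cube). [cite: Balaban1987RG1, p.257 (linear size d_j, edges of cubes)] -/
def loParam (σ : Seg d) (x : Pt d) : ℝ := sInf (paramIn (cube x) σ)

/-- The EXIT parameter of σ from the cube x (supremum of the parameters in the cube; 0 if σ misses the cube). [cite: Balaban1987RG1, p.257 (linear size d_j, edges of cubes)] -/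
def hiParam (σ : Seg d) (x : Pt d) : ℝ := sSup (paramIn (cube x) σ)

/-- The parameter set of a cube is closed. [cite: Balaban1987RG1, p.257 (linear size d_j, edges of cubes)] -/
theorem isClosed_paramIn_cube (σ : Seg d) (x : Pt d) : IsClosed (paramIn (cube x) σ) :=
  isClosed_paramIn (by unfold cube; exact isClosed_Icc) σ

/-- The entry parameter lies in [0, 1]. [cite: Balaban1987RG1, p.257 (linear size d_j, edges of cubes)] -/
theorem loParam_mem_Icc (σ : Seg d) (x : Pt d) : loParam σ x ∈ Set.Icc (0 : ℝ) 1 := by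
  by_cases hne : (paramIn (cube x) σ).Nonempty
  · exact paramIn_subset_Icc _ _ ((isClosed_paramIn_cube σ x).csInf_mem hne
      ⟨0, fun t ht => (paramIn_subset_Icc _ _ ht).1⟩)
  · rw [loParam, Set.not_nonempty_iff_eq_empty.1 hne, Real.sInf_empty]
    exact ⟨le_rfl, zero_le_one⟩

/-- The exit parameter lies in [0, 1]. [cite: Balaban1987RG1, p.257 (linear size d_j, edges of cubes)] -/
theorem hiParam_mem_Icc (σ : Seg d) (x : Pt d) : hiParam σ x ∈ Set.Icc (0 : ℝ) 1 := by
  by_cases hne : (paramIn (cube x) σ).Nonempty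
  · exact paramIn_subset_Icc _ _ ((isClosed_paramIn_cube σ x).csSup_mem hne
      ⟨1, fun t ht => (paramIn_subset_Icc _ _ ht).2⟩)
  · rw [hiParam, Set.not_nonempty_iff_eq_empty.1 hne, Real.sSup_empty]
    exact ⟨le_rfl, zero_le_one⟩

/-- COMMON CUBE: if no entry/exit parameter of a cube of X lies strictly between the parameters t ≤ t' ∈ [0, 1] of
a segment inside the cubes of X, then γ_σ([t, t']) lies in ONE cube of X (the cube containing γ_σ of the midpoint:
its entry parameter is ≤ t and its exit parameter ≥ t'). [cite: Balaban1987RG1, p.257 (linear size d_j, edges of cubes)] -/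
theorem exists_common_cube {X : Finset (Pt d)} {σ : Seg d} (hσ : segment ℝ σ.1 σ.2 ⊆ cubes X) {S : Finset ℝ}
    (hS : ∀ x ∈ X, loParam σ x ∈ S ∧ hiParam σ x ∈ S) {t t' : ℝ} (ht : 0 ≤ t) (ht' : t' ≤ 1) (htt' : t ≤ t')
    (hgap : ∀ s ∈ S, ¬ (t < s ∧ s < t')) : ∃ x ∈ X, ∀ u ∈ Set.Icc t t', gam σ u ∈ cube x := by
  set m : ℝ := (t + t') / 2 with hm
  have hm01 : m ∈ Set.Icc (0 : ℝ) 1 := ⟨by rw [hm]; linarith, by rw [hm]; linarith⟩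
  obtain ⟨x, hx, hmx⟩ := mem_cubes.1 (hσ (gam_mem_segment_of_mem_Icc σ hm01))
  have hmI : m ∈ paramIn (cube x) σ := ⟨hm01, hmx⟩
  have hbb : BddBelow (paramIn (cube x) σ) := ⟨0, fun u hu => (paramIn_subset_Icc _ _ hu).1⟩
  have hba : BddAbove (paramIn (cube x) σ) := ⟨1, fun u hu => (paramIn_subset_Icc _ _ hu).2⟩
  have hlo : loParam σ x ∈ paramIn (cube x) σ := (isClosed_paramIn_cube σ x).csInf_mem ⟨m, hmI⟩ hbb
  have hhi : hiParam σ x ∈ paramIn (cube x) σ := (isClosed_paramIn_cube σ x).csSup_mem ⟨m, hmI⟩ hba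
  have hlom : loParam σ x ≤ m := csInf_le hbb hmI
  have hmhi : m ≤ hiParam σ x := le_csSup hba hmI
  have hlot : loParam σ x ≤ t := by
    by_contra hcon
    exact hgap _ (hS x hx).1 ⟨lt_of_not_ge hcon, by rw [hm] at hlom; linarith⟩
  have hhit : t' ≤ hiParam σ x := by
    by_contra hcon
    exact hgap _ (hS x hx).2 ⟨by rw [hm] at hmhi; linarith, lt_of_not_ge hcon⟩
  refine ⟨x, hx, fun u hu => ?_⟩
  exact gam_mem_cube_of_le_of_le hlo.2 hhi.2 (hlot.trans hu.1) (hu.2.trans hhit)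

/-- THE RECTIFICATION OF A SEGMENT INSIDE THE CUBES OF X STAYS INSIDE THE CUBES OF X, provided the parameter list is
strictly increasing, in [0, 1], and contains every entry/exit parameter above its head («upward closed» in S).
[cite: Balaban1987RG1, p.257 (linear size d_j, edges of cubes)] -/
theorem carrier_rectAlong_subset {X : Finset (Pt d)} {σ : Seg d} (hσ : segment ℝ σ.1 σ.2 ⊆ cubes X)
    {S : Finset ℝ} (hS : ∀ x ∈ X, loParam σ x ∈ S ∧ hiParam σ x ∈ S) :
    ∀ {L : List ℝ}, L.Pairwise (· < ·) → (∀ u ∈ L, 0 ≤ u ∧ u ≤ 1) → (∀ s ∈ S, ∀ u ∈ L, u ≤ s → s ∈ L) →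
      carrier (rectAlong σ L) ⊆ cubes X
  | [], _, _, _ => by simp [rectAlong]
  | [t], _, h01, _ => by
      simp only [rectAlong, carrier_cons, carrier_nil, Set.union_empty]
      rw [segment_same, Set.singleton_subset_iff]
      exact hσ (gam_mem_segment_of_mem_Icc σ (h01 t (List.mem_singleton_self t)))
  | t :: t' :: L, hP, h01, hup => by
      rw [rectAlong_cons_cons, carrier_append]
      have htt' : t < t' := List.rel_of_pairwise_cons hP List.mem_cons_self
      have hP' : (t' :: L).Pairwise (· < ·) := List.Pairwise.of_cons hP
      refine Set.union_subset ?_ (carrier_rectAlong_subset hσ hS hP'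
        (fun u hu => h01 u (List.mem_cons_of_mem _ hu)) ?_)
      · have hgap : ∀ s ∈ S, ¬ (t < s ∧ s < t') := by
          rintro s hs ⟨h1, h2⟩
          have hsL : s ∈ t :: t' :: L := hup s hs t List.mem_cons_self h1.le
          rcases List.mem_cons.1 hsL with h | hsL
          · rw [h] at h1
            exact lt_irrefl _ h1
          · rcases List.mem_cons.1 hsL with h | hsL
            · rw [h] at h2
              exact lt_irrefl _ h2
            · exact lt_asymm h2 (List.rel_of_pairwise_cons hP' hsL)
        obtain ⟨x, hx, hcube⟩ := exists_common_cube hσ hS (h01 t List.mem_cons_self).1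
          (h01 t' (List.mem_cons_of_mem _ List.mem_cons_self)).2 htt'.le hgap
        exact (carrier_staircase_subset (hcube t ⟨le_rfl, htt'.le⟩) (hcube t' ⟨htt'.le, le_rfl⟩)).trans
          (cube_subset_cubes hx)
      · intro s hs u hu hus
        have hsL : s ∈ t :: t' :: L := hup s hs u (List.mem_cons_of_mem _ hu) hus
        rcases List.mem_cons.1 hsL with h | hsL
        · exfalso
          rw [h] at hus
          exact not_lt.2 hus (List.rel_of_pairwise_cons hP hu)
        · exact hsL

/-- THE CUT PARAMETERS of σ relative to the anchor set A and the domain X: 0, 1, the parameters of the anchors, and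
the entry/exit parameters of all cubes of X. [cite: Balaban1987RG1, p.257 (linear size d_j, edges of cubes)] -/
def cutParams (X : Finset (Pt d)) (A : Finset (RPt d)) (σ : Seg d) : Finset ℝ :=
  insert 0 (insert 1 (A.image (paramOf σ) ∪ (X.image (loParam σ) ∪ X.image (hiParam σ))))

/-- Cut parameters lie in [0, 1]. [cite: Balaban1987RG1, p.257 (linear size d_j, edges of cubes)] -/
theorem mem_Icc_of_mem_cutParams {X : Finset (Pt d)} {A : Finset (RPt d)} {σ : Seg d} {u : ℝ}
    (hu : u ∈ cutParams X A σ) : u ∈ Set.Icc (0 : ℝ) 1 := by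
  unfold cutParams at hu
  rw [Finset.mem_insert, Finset.mem_insert, Finset.mem_union, Finset.mem_union, Finset.mem_image,
    Finset.mem_image, Finset.mem_image] at hu
  rcases hu with rfl | rfl | ⟨c, -, rfl⟩ | ⟨x, -, rfl⟩ | ⟨x, -, rfl⟩
  · exact ⟨le_rfl, zero_le_one⟩
  · exact ⟨zero_le_one, le_rfl⟩
  · exact paramOf_mem_Icc σ c
  · exact loParam_mem_Icc σ x
  · exact hiParam_mem_Icc σ x

/-- 0 is a cut parameter. [cite: Balaban1987RG1, p.257 (linear size d_j, edges of cubes)] -/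
theorem zero_mem_cutParams (X : Finset (Pt d)) (A : Finset (RPt d)) (σ : Seg d) : (0 : ℝ) ∈ cutParams X A σ :=
  Finset.mem_insert_self _ _

/-- Anchor parameters are cut parameters. [cite: Balaban1987RG1, p.257 (linear size d_j, edges of cubes)] -/
theorem paramOf_mem_cutParams (X : Finset (Pt d)) {A : Finset (RPt d)} (σ : Seg d) {c : RPt d} (hc : c ∈ A) :
    paramOf σ c ∈ cutParams X A σ := by
  unfold cutParams
  rw [Finset.mem_insert, Finset.mem_insert, Finset.mem_union]
  exact Or.inr (Or.inr (Or.inl (Finset.mem_image_of_mem _ hc)))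

/-- Entry and exit parameters are cut parameters. [cite: Balaban1987RG1, p.257 (linear size d_j, edges of cubes)] -/
theorem loParam_hiParam_mem_cutParams {X : Finset (Pt d)} (A : Finset (RPt d)) (σ : Seg d) {x : Pt d} (hx : x ∈ X) :
    loParam σ x ∈ cutParams X A σ ∧ hiParam σ x ∈ cutParams X A σ := by
  unfold cutParams
  rw [Finset.mem_insert, Finset.mem_insert, Finset.mem_union, Finset.mem_union, Finset.mem_insert,
    Finset.mem_insert, Finset.mem_union, Finset.mem_union]
  exact ⟨Or.inr (Or.inr (Or.inr (Or.inl (Finset.mem_image_of_mem _ hx)))),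
    Or.inr (Or.inr (Or.inr (Or.inr (Finset.mem_image_of_mem _ hx))))⟩

/-! ### §6.5 The rectification of a segment -/

/-- THE RECTIFICATION of the segment σ (relative to X and the anchor set A): the rectification along the sorted cut
parameters. [cite: Balaban1987RG1, p.257 (linear size d_j, edges of cubes)] -/
def rectify (X : Finset (Pt d)) (A : Finset (RPt d)) (σ : Seg d) : List (Seg d) :=
  rectAlong σ (Finset.sort (cutParams X A σ))

/-- The rectification is rectilinear. [cite: Balaban1987RG1, p.257 (linear size d_j, edges of cubes)] -/
theorem rectilinear_rectify (X : Finset (Pt d)) (A : Finset (RPt d)) (σ : Seg d) : Rectilinear (rectify X A σ) :=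
  rectilinear_rectAlong σ _

/-- The rectification is connected. [cite: Balaban1987RG1, p.257 (linear size d_j, edges of cubes)] -/
theorem isConnected_carrier_rectify (X : Finset (Pt d)) (A : Finset (RPt d)) (σ : Seg d) :
    IsConnected (carrier (rectify X A σ)) := by
  refine isConnected_carrier_rectAlong σ (List.ne_nil_of_mem (a := (0 : ℝ)) ?_)
  exact (Finset.mem_sort _).2 (zero_mem_cutParams X A σ)

/-- ANCHORS ON σ LIE ON ITS RECTIFICATION. [cite: Balaban1987RG1, p.257 (linear size d_j, edges of cubes)] -/
theorem mem_carrier_rectify_of_mem {X : Finset (Pt d)} {A : Finset (RPt d)} {σ : Seg d} {c : RPt d} (hc : c ∈ A)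
    (hcσ : c ∈ segment ℝ σ.1 σ.2) : c ∈ carrier (rectify X A σ) := by
  have h := gam_mem_carrier_rectAlong σ ((Finset.mem_sort _).2 (paramOf_mem_cutParams X σ hc) :
    paramOf σ c ∈ Finset.sort (cutParams X A σ))
  rwa [(paramOf_spec hcσ).2] at h

/-- The endpoints of σ lie on its rectification. [cite: Balaban1987RG1, p.257 (linear size d_j, edges of cubes)] -/
theorem fst_mem_carrier_rectify (X : Finset (Pt d)) (A : Finset (RPt d)) (σ : Seg d) :
    σ.1 ∈ carrier (rectify X A σ) := by
  have h := gam_mem_carrier_rectAlong σ ((Finset.mem_sort _).2 (zero_mem_cutParams X A σ) :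
    (0 : ℝ) ∈ Finset.sort (cutParams X A σ))
  have h0 : gam σ 0 = σ.1 := by simp [gam]
  rwa [h0] at h

/-- THE RECTIFICATION IS NOT LONGER IN ℓ¹: len1 (rectify σ) ≤ |σ₁ − σ₂|₁. [cite: Balaban1987RG1, p.257 (linear size d_j, edges of cubes)] -/
theorem len1_rectify_le (X : Finset (Pt d)) (A : Finset (RPt d)) (σ : Seg d) :
    len1 (rectify X A σ) ≤ dist1 σ.1 σ.2 := by
  set L := Finset.sort (cutParams X A σ) with hL
  have hne : L ≠ [] := List.ne_nil_of_mem ((Finset.mem_sort _).2 (zero_mem_cutParams X A σ))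
  have hP : L.Pairwise (· < ·) := List.sortedLT_iff_pairwise.1 (Finset.sortedLT_sort _)
  have h1 : ∀ u ∈ L, u ≤ 1 := fun u hu => (mem_Icc_of_mem_cutParams ((Finset.mem_sort _).1 hu)).2
  have hle := len1_rectAlong_le σ hne (hP.imp le_of_lt) h1
  have hhead : 0 ≤ L.head hne := (mem_Icc_of_mem_cutParams ((Finset.mem_sort _).1 (List.head_mem hne))).1
  rw [rectify, ← hL]
  exact hle.trans (mul_le_of_le_one_left (dist1_nonneg _ _) (by linarith))

/-- THE RECTIFICATION OF A SEGMENT INSIDE THE CUBES OF X LIES INSIDE THE CUBES OF X. [cite: Balaban1987RG1, p.257 (linear size d_j, edges of cubes)] -/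
theorem carrier_rectify_subset {X : Finset (Pt d)} (A : Finset (RPt d)) {σ : Seg d}
    (hσ : segment ℝ σ.1 σ.2 ⊆ cubes X) : carrier (rectify X A σ) ⊆ cubes X := by
  refine carrier_rectAlong_subset hσ (S := cutParams X A σ) (fun x hx => loParam_hiParam_mem_cutParams A σ hx)
    (List.sortedLT_iff_pairwise.1 (Finset.sortedLT_sort _))
    (fun u hu => mem_Icc_of_mem_cutParams ((Finset.mem_sort _).1 hu)) ?_
  intro s hs _ _ _
  exact (Finset.mem_sort _).2 hs

/-! ### §6.6 Anchors and the rectification of a whole graph -/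

open Classical in
/-- A chosen common point of two segments (σ₁ if they are disjoint). [cite: Balaban1987RG1, p.257 (linear size d_j, edges of cubes)] -/
def meetPt (σ τ : Seg d) : RPt d :=
  if h : (segment ℝ σ.1 σ.2 ∩ segment ℝ τ.1 τ.2).Nonempty then h.some else σ.1

/-- The chosen common point is common. [cite: Balaban1987RG1, p.257 (linear size d_j, edges of cubes)] -/
theorem meetPt_mem {σ τ : Seg d} (h : (segment ℝ σ.1 σ.2 ∩ segment ℝ τ.1 τ.2).Nonempty) :
    meetPt σ τ ∈ segment ℝ σ.1 σ.2 ∩ segment ℝ τ.1 τ.2 := by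
  rw [meetPt, dif_pos h]
  exact h.some_mem

open Classical in
/-- A chosen point of the graph in the cube x (0 if there is none). [cite: Balaban1987RG1, p.257 (linear size d_j, edges of cubes)] -/
def cubePt (T : List (Seg d)) (x : Pt d) : RPt d :=
  if h : (carrier T ∩ cube x).Nonempty then h.some else 0

/-- The chosen point lies on the graph and in the cube. [cite: Balaban1987RG1, p.257 (linear size d_j, edges of cubes)] -/
theorem cubePt_mem {T : List (Seg d)} {x : Pt d} (h : (carrier T ∩ cube x).Nonempty) :
    cubePt T x ∈ carrier T ∩ cube x := by
  rw [cubePt, dif_pos h]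
  exact h.some_mem

open Classical in
/-- THE ANCHORS of the graph T for X: one common point for every pair of meeting segments and one point of T in every
cube of X. [cite: Balaban1987RG1, p.257 (linear size d_j, edges of cubes)] -/
def anchors (X : Finset (Pt d)) (T : List (Seg d)) : Finset (RPt d) :=
  (T.toFinset ×ˢ T.toFinset).image (fun p => meetPt p.1 p.2) ∪ X.image (cubePt T)

/-- THE RECTIFICATION OF A GRAPH: every segment replaced by its rectification relative to the anchors. [cite: Balaban1987RG1, p.257 (linear size d_j, edges of cubes)] -/
def rectifyAll (X : Finset (Pt d)) (T : List (Seg d)) : List (Seg d) :=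
  (T.map (rectify X (anchors X T))).flatten

/-- The rectification of a graph is rectilinear. [cite: Balaban1987RG1, p.257 (linear size d_j, edges of cubes)] -/
theorem rectilinear_rectifyAll (X : Finset (Pt d)) (T : List (Seg d)) : Rectilinear (rectifyAll X T) := by
  intro s hs
  rw [rectifyAll, List.mem_flatten] at hs
  obtain ⟨g, hg, hs⟩ := hs
  obtain ⟨σ, -, rfl⟩ := List.mem_map.1 hg
  exact rectilinear_rectify X _ σ s hs

/-- The rectification of a graph is not longer in ℓ¹. [cite: Balaban1987RG1, p.257 (linear size d_j, edges of cubes)] -/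
theorem len1_map_rectify_le (X : Finset (Pt d)) (A : Finset (RPt d)) :
    ∀ T : List (Seg d), len1 (T.map (rectify X A)).flatten ≤ len1 T
  | [] => by simp
  | σ :: T => by
      rw [List.map_cons, List.flatten_cons, len1_append, len1_cons]
      exact add_le_add (len1_rectify_le X A σ) (len1_map_rectify_le X A T)

/-- The rectification of a graph is not longer in ℓ¹. [cite: Balaban1987RG1, p.257 (linear size d_j, edges of cubes)] -/
theorem len1_rectifyAll_le (X : Finset (Pt d)) (T : List (Seg d)) : len1 (rectifyAll X T) ≤ len1 T :=
  len1_map_rectify_le X _ T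

/-- Carrier of the rectification of a graph. [cite: Balaban1987RG1, p.257 (linear size d_j, edges of cubes)] -/
theorem mem_carrier_rectifyAll {X : Finset (Pt d)} {T : List (Seg d)} {z : RPt d} :
    z ∈ carrier (rectifyAll X T) ↔ ∃ σ ∈ T, z ∈ carrier (rectify X (anchors X T) σ) := by
  rw [rectifyAll, mem_carrier_flatten]
  constructor
  · rintro ⟨g, hg, hz⟩
    obtain ⟨σ, hσ, rfl⟩ := List.mem_map.1 hg
    exact ⟨σ, hσ, hz⟩
  · rintro ⟨σ, hσ, hz⟩
    exact ⟨_, List.mem_map.2 ⟨σ, hσ, rfl⟩, hz⟩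

/-- THE RECTIFICATION OF AN ADMISSIBLE GRAPH IS CONNECTED: the intersection graph of the segments of T is connected
(`B12ShortestGraph257.reflTransGen_of_isPreconnected_iUnion`), meeting segments have a common ANCHOR which lies on
both rectifications, and each rectification is connected (Mathlib `IsConnected.iUnion_of_reflTransGen`).
[cite: Balaban1987RG1, p.257 (linear size d_j, edges of cubes)] -/
theorem isConnected_carrier_rectifyAll {X : Finset (Pt d)} {T : List (Seg d)} (hT : Admissible X T) :
    IsConnected (carrier (rectifyAll X T)) := by
  classical
  have hTne : T ≠ [] := by
    rintro rfl
    simpa using hT.connected.nonempty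
  obtain ⟨σ₀, hσ₀⟩ := List.exists_mem_of_ne_nil T hTne
  haveI : Nonempty {σ : Seg d // σ ∈ T} := ⟨⟨σ₀, hσ₀⟩⟩
  have hU : (⋃ i : {σ : Seg d // σ ∈ T}, segment ℝ i.1.1 i.1.2) = carrier T := by
    ext z
    simp only [Set.mem_iUnion, mem_carrier]
    constructor
    · rintro ⟨⟨σ, hσ⟩, hz⟩
      exact ⟨σ, hσ, hz⟩
    · rintro ⟨σ, hσ, hz⟩
      exact ⟨⟨σ, hσ⟩, hz⟩
  have hK₀ := reflTransGen_of_isPreconnected_iUnion (s := fun i : {σ : Seg d // σ ∈ T} => segment ℝ i.1.1 i.1.2)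
    (by rw [hU]; exact hT.connected.isPreconnected) (fun i => isClosed_segment' i.1)
    (fun i => ⟨_, left_mem_segment ℝ _ _⟩)
  have hU' : (⋃ i : {σ : Seg d // σ ∈ T}, carrier (rectify X (anchors X T) i.1)) = carrier (rectifyAll X T) := by
    ext z
    rw [mem_carrier_rectifyAll, Set.mem_iUnion]
    constructor
    · rintro ⟨⟨σ, hσ⟩, hz⟩
      exact ⟨σ, hσ, hz⟩
    · rintro ⟨σ, hσ, hz⟩
      exact ⟨⟨σ, hσ⟩, hz⟩
  rw [← hU']
  refine IsConnected.iUnion_of_reflTransGen (fun i => isConnected_carrier_rectify X _ i.1) fun i j => ?_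
  have h := hK₀ i j
  induction h with
  | refl => exact ReflTransGen.refl
  | @tail b c _ hbc ih =>
      refine ih.tail ?_
      have hm := meetPt_mem hbc
      have hA : meetPt b.1 c.1 ∈ anchors X T := by
        unfold anchors
        refine Finset.mem_union_left _ (Finset.mem_image.2 ⟨(b.1, c.1), ?_, rfl⟩)
        exact Finset.mem_product.2 ⟨List.mem_toFinset.2 b.2, List.mem_toFinset.2 c.2⟩
      exact ⟨_, mem_carrier_rectify_of_mem hA hm.1, mem_carrier_rectify_of_mem hA hm.2⟩

/-- PHASE I — THE RECTIFICATION OF AN ADMISSIBLE GRAPH IS ADMISSIBLE. [cite: Balaban1987RG1, p.257 (linear size d_j, edges of cubes)] -/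
theorem admissible_rectifyAll {X : Finset (Pt d)} {T : List (Seg d)} (hT : Admissible X T) :
    Admissible X (rectifyAll X T) := by
  refine ⟨isConnected_carrier_rectifyAll hT, ?_, ?_⟩
  · intro z hz
    obtain ⟨σ, hσ, hz⟩ := mem_carrier_rectifyAll.1 hz
    exact carrier_rectify_subset _ ((segment_subset_carrier hσ).trans hT.subset) hz
  · intro x hx
    have hc := cubePt_mem (hT.meets x hx)
    obtain ⟨σ, hσ, hcσ⟩ := mem_carrier.1 hc.1
    have hA : cubePt T x ∈ anchors X T := by
      classical
      unfold anchors
      exact Finset.mem_union_right _ (Finset.mem_image_of_mem _ hx)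
    exact ⟨cubePt T x, mem_carrier_rectifyAll.2 ⟨σ, hσ, mem_carrier_rectify_of_mem hA hcσ⟩, hc.2⟩

/-- PHASE I, SUMMARY: every admissible graph is dominated in ℓ¹ length by a rectilinear admissible graph. [cite: Balaban1987RG1, p.257 (linear size d_j, edges of cubes)] -/
theorem exists_rectilinear_admissible {X : Finset (Pt d)} {T : List (Seg d)} (hT : Admissible X T) :
    ∃ T', Admissible X T' ∧ Rectilinear T' ∧ len1 T' ≤ len1 T :=
  ⟨rectifyAll X T, admissible_rectifyAll hT, rectilinear_rectifyAll X T, len1_rectifyAll_le X T⟩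

/-! ## §7. THE ℓ¹ READING OF p. 257: `treeLen1 = edgeLen` — «there are also the shortest tree graphs formed by
edges of cubes» holds EXACTLY for the ℓ¹ length -/

/-- FOR EVERY ADMISSIBLE GRAPH, `edgeLen X ≤ len1 T` (Phases I–III). [cite: Balaban1987RG1, p.257 (linear size d_j, edges of cubes)] -/
theorem edgeLen_le_len1 {X : Finset (Pt d)} {T : List (Seg d)} (hT : Admissible X T) : (edgeLen X : ℝ) ≤ len1 T := by
  obtain ⟨T', h1, h2, h3⟩ := exists_rectilinear_admissible hT
  exact (edgeLen_le_len1_of_rectilinear h1 h2).trans h3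

/-- A set of cubes carrying an admissible graph carries an admissible EDGE graph. [cite: Balaban1987RG1, p.257 (linear size d_j, edges of cubes)] -/
theorem exists_eAdmissible_of_admissible {X : Finset (Pt d)} {T : List (Seg d)} (hT : Admissible X T) :
    ∃ E, EAdmissible X E := by
  obtain ⟨T', h1, h2, -⟩ := exists_rectilinear_admissible hT
  obtain ⟨T'', h1', h2', h3', -⟩ := exists_lattice_of_rectilinear _ T' h1 h2 le_rfl
  obtain ⟨E, hE1, hE2, hE3, -⟩ := exists_eAdmissible_of_rectilinear_lattice T'' h2' h3'
    (fun s hs => (segment_subset_carrier hs).trans h1'.subset)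
  exact ⟨E, hE1, hE2, ⟨by rw [hE3]; exact h1'.connected, by rw [hE3]; exact h1'.subset,
    by rw [hE3]; exact h1'.meets⟩⟩

/-- `edgeLen X ≤ treeLen1 X`. [cite: Balaban1987RG1, p.257 (linear size d_j, edges of cubes)] -/
theorem edgeLen_le_treeLen1 {X : Finset (Pt d)} (hne : ∃ T, Admissible X T) : (edgeLen X : ℝ) ≤ treeLen1 X :=
  le_treeLen1 hne fun _ hT => edgeLen_le_len1 hT

/-- THE ℓ¹ READING OF THE SENTENCE OF p. 257 — «It is easy to see that there are also the shortest tree graphs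
formed by edges of cubes in X, hence an equivalent definition can be formulated, based on such graphs only»: for the
ℓ¹ length of polygonal graphs the continuum linear size EQUALS the edge length, `treeLen1 X = edgeLen X`, for every
finite set of cubes X carrying an admissible graph (whereas for the sup-metric length of record and for the
Euclidean length the two differ, `B12EdgeTreeLength257` §6/§11). [cite: Balaban1987RG1, p.257 (linear size d_j, edges of cubes)] -/
theorem treeLen1_eq_edgeLen {X : Finset (Pt d)} (hne : ∃ T, Admissible X T) : treeLen1 X = (edgeLen X : ℝ) := by
  obtain ⟨T, hT⟩ := hne
  exact le_antisymm (treeLen1_le_edgeLen (exists_eAdmissible_of_admissible hT)) (edgeLen_le_treeLen1 ⟨T, hT⟩)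

/-- ATTAINMENT BY AN EDGE GRAPH: a shortest admissible EDGE graph is an ℓ¹-shortest admissible graph — «there are
also the shortest tree graphs formed by edges of cubes in X». [cite: Balaban1987RG1, p.257 (linear size d_j, edges of cubes)] -/
theorem exists_edgeGraph_len1_eq_treeLen1 {X : Finset (Pt d)} (hne : ∃ T, Admissible X T) :
    ∃ E, EAdmissible X E ∧ len1 (toSegs E) = treeLen1 X ∧ (nedges E : ℝ) = treeLen1 X := by
  obtain ⟨T, hT⟩ := hne
  obtain ⟨E, hE, hn⟩ := exists_eAdmissible_nedges_eq (exists_eAdmissible_of_admissible hT)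
  refine ⟨E, hE, ?_, ?_⟩
  · rw [len1_toSegs hE.lattice, hn, treeLen1_eq_edgeLen ⟨T, hT⟩]
  · rw [hn, treeLen1_eq_edgeLen ⟨T, hT⟩]

/-- The ℓ¹ linear size is attained («a length of a shortest graph», ℓ¹ reading). [cite: Balaban1987RG1, p.257 (linear size d_j, edges of cubes)] -/
theorem exists_admissible_len1_eq_treeLen1 {X : Finset (Pt d)} (hne : ∃ T, Admissible X T) :
    ∃ T, Admissible X T ∧ len1 T = treeLen1 X := by
  obtain ⟨E, hE, h, -⟩ := exists_edgeGraph_len1_eq_treeLen1 hne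
  exact ⟨toSegs E, hE.admissible, h⟩

/-- For every LOCALIZATION DOMAIN (non-empty, face-connected Y): `treeLen1 Y = edgeLen Y`. [cite: Balaban1987RG1, p.257 (linear size d_j, edges of cubes)] -/
theorem treeLen1_eq_edgeLen_of_faceConnected {Y : Finset (Pt d)} (hY : Y.Nonempty) (hc : FaceConnected Y) :
    treeLen1 Y = (edgeLen Y : ℝ) := by
  obtain ⟨T, hT, -⟩ := exists_admissible hY hc
  exact treeLen1_eq_edgeLen ⟨T, hT⟩

/-- COMPARISON WITH THE LENGTH OF RECORD: `treeLen X ≤ treeLen1 X = edgeLen X`, and the first inequality is STRICT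
for the 3^d block in every dimension d ≥ 2 (`B12EdgeTreeLength257.treeLen_block_lt_edgeLen_block`): the sup-metric
and the ℓ¹ linear sizes are different functionals. [cite: Balaban1987RG1, p.257 (linear size d_j, edges of cubes)] -/
theorem treeLen_block_lt_treeLen1_block (hd : 2 ≤ d) (c : Pt d) :
    treeLen (B13ScaleTransfer.block c) < treeLen1 (B13ScaleTransfer.block c) := by
  rw [treeLen1_eq_edgeLen ⟨_, admissible_star c⟩]
  exact treeLen_block_lt_edgeLen_block hd c


/-! ## §8 (revision v1.1, append-only; §§1–7 byte-identical to v1.0 = p320347). THE LINEAR COMPARISON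
`treeLen X ≤ edgeLen X ≤ d · treeLen X` — the «equivalent definition» up to the factor d (sharpening the affine
comparison `B12EdgeTreeLength257.edgeLen_le_affine_treeLen`, 4·2^d·treeLen + (2^d − 1), by way of the ℓ¹ reading:
ℓ¹ ≤ d · sup on ℝ^d) -/

/-- ℓ¹ ≤ d · sup on ℝ^d. [cite: Balaban1987RG1, p.257 (linear size d_j, edges of cubes)] -/
theorem dist1_le_mul_dist (p q : RPt d) : dist1 p q ≤ d * dist p q := by
  unfold dist1
  calc ∑ i, |p i - q i| ≤ ∑ _i : Fin d, dist p q :=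
        Finset.sum_le_sum fun i _ => by rw [← Real.dist_eq]; exact dist_le_pi_dist p q i
    _ = d * dist p q := by rw [Finset.sum_const, Finset.card_univ, Fintype.card_fin, nsmul_eq_mul]

/-- The ℓ¹ length of a graph is at most d times its sup-metric length. [cite: Balaban1987RG1, p.257 (linear size d_j, edges of cubes)] -/
theorem len1_le_mul_len : ∀ T : List (Seg d), len1 T ≤ d * len T
  | [] => by simp
  | s :: T => by
      rw [len1_cons, len_cons, mul_add]
      exact add_le_add (dist1_le_mul_dist _ _) (len1_le_mul_len T)

/-- The ℓ¹ linear size is at most d times the linear size of record. [cite: Balaban1987RG1, p.257 (linear size d_j, edges of cubes)] -/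
theorem treeLen1_le_mul_treeLen {X : Finset (Pt d)} (hne : ∃ T, Admissible X T) :
    treeLen1 X ≤ d * treeLen X := by
  obtain ⟨T, hT, hlen⟩ := exists_admissible_len_eq_treeLen hne
  rw [← hlen]
  exact (treeLen1_le_len1 hT).trans (len1_le_mul_len T)

/-- THE LINEAR COMPARISON, upper half: `edgeLen X ≤ d · treeLen X` for every finite set of unit cubes carrying an
admissible graph (the length of record is the sup metric; by `treeLen1_eq_edgeLen` and ℓ¹ ≤ d · sup). [cite: Balaban1987RG1, p.257 (linear size d_j, edges of cubes)] -/
theorem edgeLen_le_mul_treeLen {X : Finset (Pt d)} (hne : ∃ T, Admissible X T) :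
    (edgeLen X : ℝ) ≤ d * treeLen X := by
  rw [← treeLen1_eq_edgeLen hne]
  exact treeLen1_le_mul_treeLen hne

/-- THE LINEAR COMPARISON for localization domains: treeLen Y ≤ edgeLen Y ≤ d · treeLen Y — the printed «equivalent
definition» holds for the length of record up to the factor d (and exactly for the ℓ¹ length, §7). [cite: Balaban1987RG1, p.257 (linear size d_j, edges of cubes)] -/
theorem treeLen_le_edgeLen_le_mul_treeLen {Y : Finset (Pt d)} (hY : Y.Nonempty) (hc : FaceConnected Y) :
    treeLen Y ≤ (edgeLen Y : ℝ) ∧ (edgeLen Y : ℝ) ≤ d * treeLen Y := by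
  obtain ⟨T, hT, -⟩ := exists_admissible hY hc
  exact ⟨treeLen_le_edgeLen_of_faceConnected hY hc, edgeLen_le_mul_treeLen ⟨T, hT⟩⟩

/-- The paper's dimension d = 4: edgeLen Y ≤ 4 · d_j(Y) for every localization domain (v1.0 of
`B12EdgeTreeLength257` had 64 · d_j(Y) + 15). [cite: Balaban1987RG1, p.257 (linear size d_j, edges of cubes)] -/
theorem edgeLen_le_four_mul_treeLen {Y : Finset (Pt 4)} (hY : Y.Nonempty) (hc : FaceConnected Y) :
    (edgeLen Y : ℝ) ≤ 4 * treeLen Y := by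
  have h := (treeLen_le_edgeLen_le_mul_treeLen hY hc).2
  norm_num at h
  exact h

/-- The 3^d block for comparison: edgeLen = 2^d − 1 while treeLen ≤ 2^(d−1) (`B12EdgeTreeLength257.treeLen_block_le`,
`edgeLen_block_add_one`); recorded as the pair of facts, no sharpness claim for the factor d. [cite: Balaban1987RG1, p.257 (linear size d_j, edges of cubes)] -/
theorem block_comparison (c : Pt d) :
    (edgeLen (B13ScaleTransfer.block c) : ℝ) + 1 = (2 : ℝ) ^ d ∧
      treeLen (B13ScaleTransfer.block c) ≤ (2 : ℝ) ^ d / 2 := by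
  refine ⟨?_, treeLen_block_le c⟩
  exact_mod_cast edgeLen_block_add_one c


/-! ## §9 (revision v1.2, append-only; §§1–8 byte-identical to v1.1). THE THREE USUAL NORMS: the Euclidean linear
size `treeLen2` (infimum of `B12EdgeTreeLength257.elen`), the chain  treeLen ≤ treeLen2 ≤ treeLen1 = edgeLen  and the
factors  edgeLen ≤ √d · treeLen2,  edgeLen ≤ d · treeLen  (sup: factor d, Euclidean: factor √d, ℓ¹: exact) -/

/-- The Euclidean distance is non-negative. [cite: Balaban1987RG1, p.257 (linear size d_j, edges of cubes)] -/
theorem edist2_nonneg (p q : RPt d) : 0 ≤ edist2 p q := Real.sqrt_nonneg _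

/-- sup ≤ ℓ². [cite: Balaban1987RG1, p.257 (linear size d_j, edges of cubes)] -/
theorem dist_le_edist2 (p q : RPt d) : dist p q ≤ edist2 p q := by
  rw [dist_pi_le_iff (edist2_nonneg p q)]
  intro i
  rw [Real.dist_eq, edist2]
  refine Real.abs_le_sqrt ?_
  exact Finset.single_le_sum (f := fun j => (p j - q j) ^ 2) (fun j _ => sq_nonneg _) (Finset.mem_univ i)

/-- ℓ² ≤ ℓ¹. [cite: Balaban1987RG1, p.257 (linear size d_j, edges of cubes)] -/
theorem edist2_le_dist1 (p q : RPt d) : edist2 p q ≤ dist1 p q := by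
  rw [edist2, dist1, Real.sqrt_le_left (Finset.sum_nonneg fun i _ => abs_nonneg _)]
  calc ∑ i, (p i - q i) ^ 2 = ∑ i, |p i - q i| ^ 2 := Finset.sum_congr rfl fun i _ => (sq_abs _).symm
    _ ≤ (∑ i, |p i - q i|) ^ 2 := Finset.sum_sq_le_sq_sum_of_nonneg fun i _ => abs_nonneg _

/-- ℓ¹ ≤ √d · ℓ² (Cauchy–Schwarz). [cite: Balaban1987RG1, p.257 (linear size d_j, edges of cubes)] -/
theorem dist1_le_sqrt_mul_edist2 (p q : RPt d) : dist1 p q ≤ Real.sqrt d * edist2 p q := by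
  rw [edist2, ← Real.sqrt_mul (Nat.cast_nonneg d), dist1,
    Real.le_sqrt (Finset.sum_nonneg fun i _ => abs_nonneg _) (by positivity)]
  have h := Finset.sum_mul_sq_le_sq_mul_sq Finset.univ (fun i : Fin d => |p i - q i|) (fun _ => (1 : ℝ))
  simp only [mul_one, one_pow, Finset.sum_const, Finset.card_univ, Fintype.card_fin, nsmul_eq_mul, sq_abs] at h
  linarith

/-- Euclidean lengths are non-negative. [cite: Balaban1987RG1, p.257 (linear size d_j, edges of cubes)] -/
theorem elen_nonneg : ∀ T : List (Seg d), 0 ≤ elen T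
  | [] => le_rfl
  | s :: T => by rw [elen_cons]; exact add_nonneg (edist2_nonneg _ _) (elen_nonneg T)

/-- len ≤ elen ≤ len1 ≤ √d · elen, segment by segment. [cite: Balaban1987RG1, p.257 (linear size d_j, edges of cubes)] -/
theorem len_le_elen_le_len1 : ∀ T : List (Seg d), len T ≤ elen T ∧ elen T ≤ len1 T ∧ len1 T ≤ Real.sqrt d * elen T
  | [] => by simp
  | s :: T => by
      obtain ⟨h1, h2, h3⟩ := len_le_elen_le_len1 T
      rw [len_cons, elen_cons, len1_cons, mul_add]
      exact ⟨add_le_add (dist_le_edist2 _ _) h1, add_le_add (edist2_le_dist1 _ _) h2,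
        add_le_add (dist1_le_sqrt_mul_edist2 _ _) h3⟩

/-- The set of Euclidean lengths of the admissible graphs for X. [cite: Balaban1987RG1, p.257 (linear size d_j, edges of cubes)] -/
def lengths2 (X : Finset (Pt d)) : Set ℝ := {ℓ | ∃ T, Admissible X T ∧ elen T = ℓ}

/-- THE EUCLIDEAN LINEAR SIZE: the infimum of the Euclidean lengths of the admissible graphs for X (the ℓ² reading
of «a length of a shortest graph in this class»). [cite: Balaban1987RG1, p.257 (linear size d_j, edges of cubes)] -/
def treeLen2 (X : Finset (Pt d)) : ℝ := sInf (lengths2 X)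

/-- `lengths2 X` is bounded below by 0. [cite: Balaban1987RG1, p.257 (linear size d_j, edges of cubes)] -/
theorem bddBelow_lengths2 (X : Finset (Pt d)) : BddBelow (lengths2 X) :=
  ⟨0, by rintro _ ⟨T, -, rfl⟩; exact elen_nonneg T⟩

/-- The Euclidean linear size is at most the Euclidean length of any admissible graph. [cite: Balaban1987RG1, p.257 (linear size d_j, edges of cubes)] -/
theorem treeLen2_le_elen {X : Finset (Pt d)} {T : List (Seg d)} (h : Admissible X T) : treeLen2 X ≤ elen T :=
  csInf_le (bddBelow_lengths2 X) ⟨T, h, rfl⟩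

/-- A lower bound of all admissible Euclidean lengths bounds the Euclidean linear size from below. [cite: Balaban1987RG1, p.257 (linear size d_j, edges of cubes)] -/
theorem le_treeLen2 {X : Finset (Pt d)} {a : ℝ} (hne : ∃ T, Admissible X T)
    (h : ∀ T, Admissible X T → a ≤ elen T) : a ≤ treeLen2 X := by
  obtain ⟨T₀, hT₀⟩ := hne
  refine le_csInf ⟨elen T₀, T₀, hT₀, rfl⟩ ?_
  rintro _ ⟨T, hT, rfl⟩
  exact h T hT

/-- THE CHAIN: treeLen X ≤ treeLen2 X ≤ treeLen1 X (= edgeLen X). [cite: Balaban1987RG1, p.257 (linear size d_j, edges of cubes)] -/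
theorem treeLen_le_treeLen2_le_treeLen1 {X : Finset (Pt d)} (hne : ∃ T, Admissible X T) :
    treeLen X ≤ treeLen2 X ∧ treeLen2 X ≤ treeLen1 X :=
  ⟨le_treeLen2 hne fun T hT => (treeLen_le_len hT).trans (len_le_elen_le_len1 T).1,
    le_treeLen1 hne fun T hT => (treeLen2_le_elen hT).trans (len_le_elen_le_len1 T).2.1⟩

/-- THE EUCLIDEAN FACTOR: treeLen1 X ≤ √d · treeLen2 X. [cite: Balaban1987RG1, p.257 (linear size d_j, edges of cubes)] -/
theorem treeLen1_le_sqrt_mul_treeLen2 {X : Finset (Pt d)} (hne : ∃ T, Admissible X T) :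
    treeLen1 X ≤ Real.sqrt d * treeLen2 X := by
  rcases Nat.eq_zero_or_pos d with hd | hd
  · -- d = 0: every distance vanishes, treeLen1 X = 0
    subst hd
    obtain ⟨T, hT⟩ := hne
    have h0 : ∀ T : List (Seg 0), len1 T = 0 := by
      intro T
      induction T with
      | nil => rfl
      | cons s T ih => rw [len1_cons, ih, add_zero]; simp [dist1]
    have h1 : treeLen1 X ≤ 0 := (treeLen1_le_len1 hT).trans (h0 T).le
    simp only [Nat.cast_zero, Real.sqrt_zero, zero_mul]
    exact h1
  · have hsd : 0 < Real.sqrt d := Real.sqrt_pos.2 (by exact_mod_cast hd)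
    have h : treeLen1 X / Real.sqrt d ≤ treeLen2 X := by
      refine le_treeLen2 hne fun T hT => ?_
      rw [div_le_iff₀ hsd, mul_comm]
      exact (treeLen1_le_len1 hT).trans (len_le_elen_le_len1 T).2.2
    rwa [div_le_iff₀ hsd, mul_comm] at h

/-- THE THREE USUAL NORMS AT ONCE (every finite set of unit cubes carrying an admissible graph):
treeLen ≤ treeLen2 ≤ treeLen1 = edgeLen, edgeLen ≤ √d · treeLen2, edgeLen ≤ d · treeLen — the printed «equivalent
definition» holds exactly for ℓ¹, up to the factor √d for the Euclidean length and up to the factor d for the sup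
length of record. [cite: Balaban1987RG1, p.257 (linear size d_j, edges of cubes)] -/
theorem three_norms {X : Finset (Pt d)} (hne : ∃ T, Admissible X T) :
    treeLen X ≤ treeLen2 X ∧ treeLen2 X ≤ (edgeLen X : ℝ) ∧ treeLen1 X = (edgeLen X : ℝ) ∧
      (edgeLen X : ℝ) ≤ Real.sqrt d * treeLen2 X ∧ (edgeLen X : ℝ) ≤ d * treeLen X := by
  obtain ⟨h1, h2⟩ := treeLen_le_treeLen2_le_treeLen1 hne
  have h3 := treeLen1_eq_edgeLen hne
  refine ⟨h1, by rw [← h3]; exact h2, h3, ?_, edgeLen_le_mul_treeLen hne⟩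
  rw [← h3]
  exact treeLen1_le_sqrt_mul_treeLen2 hne

/-- The Euclidean linear size of the 3 × 3 block (d = 2) is STRICTLY below its edge length: treeLen2 ≤ 2√2 < 3 =
edgeLen (`B12EdgeTreeLength257.euclidean_separation_block_two`, `edgeLen_block_add_one`). [cite: Balaban1987RG1, p.257 (linear size d_j, edges of cubes)] -/
theorem treeLen2_block_two_lt_edgeLen (c : Pt 2) :
    treeLen2 (B13ScaleTransfer.block c) < (edgeLen (B13ScaleTransfer.block c) : ℝ) := by
  obtain ⟨hadm, hlt, -⟩ := euclidean_separation_block_two c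
  have h3 : (edgeLen (B13ScaleTransfer.block c) : ℝ) = 3 := by
    have h := edgeLen_block_add_one c
    have h' : ((edgeLen (B13ScaleTransfer.block c) : ℕ) : ℝ) + 1 = (2 : ℝ) ^ 2 := by exact_mod_cast h
    linarith
  rw [h3]
  exact (treeLen2_le_elen hadm).trans_lt hlt

end

end Literature.MathematicalPhysics.QuantumFieldTheory.Balaban1983to89.B12EdgeTreeLength257L1
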